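import Literature.NumberTheory.Automorphic.PicardCMSpecialCyclesAlgebraic
import Literature.AlgebraicGeometry.ShimuraVarieties.SpecialCycleClasses
import Literature.AlgebraicGeometry.HodgeTheory.HodgeSectionRestrictionProofs
import Mathlib.Topology.Instances.Complex
import Mathlib.NumberTheory.NumberField.CMField
import HarnessLib

/-!
# Non-vacuity of the special cycles of a compact ball quotient: totally positive lines exist, and
# their special curves are non-empty proper subvarieties

Topic `AlgebraicGeometry/ShimuraVarieties`; namespace `Literature.AlgebraicGeometry.ShimuraVarieties`
(datum API dotted on `UnitaryBallUniformisationDatum` / `UnitaryBallQuotientDatum`). **No named facts, no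
`sorry`**; imports = tree only.

Bergeron–Millson–Moeglin (BMM), *The Hodge conjecture and arithmetic quotients of complex balls*, Acta
Math. 216 (2016), Introduction §1.7: "We may associate to an `n`-dimensional totally positive Hermitian
subspace of `V` a special cycle of complex codimension `nq` in `S`"; Kudla–Millson, Publ. Math. IHÉS 71
(1990), §2 pp. 129–131: the cycles of definite type `C_U = Γ_U \ D_U`, `D_U = {Z ∈ D : Z ⊆ U^⊥}`, attached to
the positive definite rational subspaces `U`. The tree records these over a `ℂ`-scheme `X` carrying a
`UnitaryBallQuotientDatum p X` (`ShimuraVarieties/UnitaryBallQuotientDatum`): for every TOTALLY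
POSITIVE DEFINITE `E`-subspace `W ⊆ V = E^{p+1}` (`IsTotallyPositive`) a Zariski-closed
`D.specialSubvariety W ⊆ X` whose complex points are the images of the sub-ball `𝔹(W^⊥)` and whose
points have codimension `≥ dim_E W`; the special cycle classes `specialCycleClasses D k`
(`ShimuraVarieties/SpecialCycleClasses`) are the `⨆` over the totally positive `W` of dimension `k` of
the classes supported on `D.specialSubvariety W`.

This file proves that these records are NOT VACUOUS in the first interesting degree (the `k = 1`
non-vacuity instance of the Layer-C definitions tribunal, row V-C4.i / P-C4-04 of the foundations
lane):

* `exists_isTotallyPositive_span_singleton` — for a CM field `E ⊆ ℂ` and a hermitian Gram matrix `H`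
  on `E^{p+1}`, `p ≥ 1`, of signature `(p, 1)` at the distinguished place (a Sylvester frame
  `Tᴴ H^{τ₁} T = diag(1,…,1,-1)`) and positive definite at the other complex embeddings, there is a
  vector `w ∈ E^{p+1}`, `w ≠ 0`, spanning a TOTALLY POSITIVE LINE `E ∙ w`. Proof: the first column
  `t₀` of the frame has `⟪t₀, t₀⟫ = 1 > 0`; the positive cone `{v | Re ⟪v, v⟫ > 0} ⊆ ℂ^{p+1}` is
  open, and `E^{p+1}` is dense in `ℂ^{p+1}` because a CM subfield of `ℂ` is not contained in `ℝ`
  (`dense_coe_of_isCMField`, from Mathlib's `Complex.subfield_eq_of_closed`); positivity at the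
  conjugate embedding is positivity at `τ₁` (`Re conj z = Re z`), and at the remaining embeddings it is
  the positive definiteness of `H` there. Datum form:
  `UnitaryBallUniformisationDatum.exists_isTotallyPositive_finrank_eq_one`.
* `exists_mem_negCone_hermForm_eq_zero` — in signature `(p, 1)`, every positive vector `u` has a
  NEGATIVE vector orthogonal to it (explicitly `v = t_p - (⟪u, t_p⟫ / ⟪u, u⟫) u`, `t_p` the negative
  frame column: `⟪v, v⟫ = -1 - |a|² ⟪u, u⟫`); hence the sub-ball `𝔹(W^⊥)` of a totally positive LINE
  `W` is non-empty and the special curve `c(W)` has complex points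
  (`UnitaryBallQuotientDatum.exists_pt_mem_specialSubvariety`).
* `UnitaryBallQuotientDatum.specialSubvariety_ne_univ`, `exists_pt_notMem_specialSubvariety` — for
  `W ≠ 0` totally positive the special subvariety is a PROPER closed subset and misses a complex
  point: its points have codimension `≥ dim_E W ≥ 1` (codimension clause of the datum), while the
  generic point of the irreducible smooth projective `X` has codimension `0`
  (`HodgeTheory.exists_notMem_of_coheight`); a non-empty Zariski-open subset of a scheme locally of
  finite type over `ℂ` has a complex point (Jacobson, `exists_pt_mem_of_isOpen`).
* `UnitaryBallUniformisationDatum.exists_pt_notMem_image_unif_subCone` — the same for the bare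
  uniformisation datum in dimension `p = 2`, where the special subvariety is supplied by the THEOREM
  `PicardCM.specialCyclesAlgebraic_holds` (Kudla–Millson Lemma 1.1 / p. 133 + Chow, proved in the
  tree): the image `unif '' subCone(τ₁ W)` of the sub-ball misses a complex point of `X`.
* `UnitaryBallQuotientDatum.exists_isTotallyPositive_line_specialSubvariety_ne_univ` — the packaged
  `k = 1` statement: a Picard-type datum of dimension `p ≥ 1` has a totally positive line `W` whose
  special subvariety is non-empty on complex points and is not all of `X`.

Sequels in this file: §v2 below (`k = 2`: totally positive planes, special points of the surface) and
§v3 (EVERY `k ≤ p`: totally positive subspaces of every dimension `k ≤ p` exist, every sub-ball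
`𝔹(W^⊥)` is non-empty, and the special subvarieties are non-empty and proper exactly for
`1 ≤ k ≤ p`). Not here: any statement about the classes `cl(c(W))` themselves (non-vanishing of
special cycle classes is a theorem of Kudla–Millson / BMM, not a validation instance).

## References

* [BergeronMillsonMoeglin2016Balls] N. Bergeron, J. Millson, C. Moeglin, Acta Math. 216 (2016),
  Introduction §§1.1, 1.7; Part 2 §§1.1–1.3, 3.2–3.3.
* [KudlaMillson1990] S. Kudla, J. Millson, Publ. Math. IHÉS 71 (1990), §1 Lemma 1.1 p. 128, §2 pp. 129–131,
  p. 133.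

## Provenance

Written for the foundations lane `lit-hodgefound` (Layer C, row P-C4-04 = TRIBUNAL-C V-C4.i), seat p15.
Nothing in this file is a claim of any manuscript under adjudication.
-/

set_option autoImplicit false

noncomputable section

open Matrix NumberField Complex
open scoped ComplexOrder ComplexConjugate

namespace Literature.AlgebraicGeometry.ShimuraVarieties

open Literature.AlgebraicGeometry.Motives (SchemeOver ComplexPoints IsSmoothProjective AlgPoints)

/-! ### A CM subfield of `ℂ` is dense -/

section Density

/-- **A CM subfield of `ℂ` is dense in `ℂ`.** A CM field is totally complex, so the inclusion
`E ⊆ ℂ` is not a real embedding and `E` contains a non-real number; the closure of `E` is a closed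
subfield of `ℂ`, hence `ℝ` or `ℂ` (Mathlib `Complex.subfield_eq_of_closed`), and it is not `ℝ`.
[folklore] -/
private theorem dense_coe_of_isCMField (E : Subfield ℂ) [NumberField E] [IsCMField E] :
    Dense (E : Set ℂ) := by
  have hnr : ¬ ComplexEmbedding.IsReal E.subtype := IsTotallyComplex.complexEmbedding_not_isReal _
  rw [ComplexEmbedding.isReal_iff] at hnr
  obtain ⟨x, hx⟩ : ∃ x : E, conj (x : ℂ) ≠ x := by
    by_contra h
    push Not at h
    exact hnr (RingHom.ext fun x ↦ by
      rw [ComplexEmbedding.conjugate_coe_eq]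
      exact h x)
  rcases Complex.subfield_eq_of_closed E.isClosed_topologicalClosure with h1 | h1
  · exfalso
    have hmem : (x : ℂ) ∈ E.topologicalClosure := E.le_topologicalClosure x.2
    rw [h1, RingHom.mem_fieldRange] at hmem
    obtain ⟨r, hr⟩ := hmem
    exact hx (by rw [← hr]; exact Complex.conj_ofReal r)
  · rw [dense_iff_closure_eq]
    have hc : ((E.topologicalClosure : Subfield ℂ) : Set ℂ) = closure (E : Set ℂ) := rfl
    rw [← hc, h1]
    rfl

/-- `E^{n}` is dense in `ℂⁿ` for a CM subfield `E ⊆ ℂ`: every non-empty open subset of `ℂⁿ` contains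
a vector with coordinates in `E`. [folklore] -/
private theorem exists_coe_mem_of_isOpen (E : Subfield ℂ) [NumberField E] [IsCMField E] {n : ℕ}
    {O : Set (Fin n → ℂ)} (hO : IsOpen O) (hne : O.Nonempty) :
    ∃ w : Fin n → E, (fun i ↦ (w i : ℂ)) ∈ O := by
  have hd : Dense (Set.pi Set.univ fun _ : Fin n ↦ (E : Set ℂ)) :=
    dense_pi Set.univ fun _ _ ↦ dense_coe_of_isCMField E
  obtain ⟨v, hv, hvO⟩ := hd.exists_mem_open hO hne
  exact ⟨fun i ↦ ⟨v i, hv i (Set.mem_univ i)⟩, hvO⟩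

end Density

/-! ### Sesquilinearity and hermitian symmetry of `hermForm` -/

section Hermitian

variable {R : Type*} [CommRing R] {m : Type*} [Fintype m]

/-- Sesquilinearity of the Gram-matrix form: `⟪a • u, b • v⟫ = σ(a) b ⟪u, v⟫`. [folklore] -/
private theorem hermForm_smul_smul_eq (σ : R →+* R) (H : Matrix m m R) (a b : R) (u v : m → R) :
    hermForm σ H (a • u) (b • v) = σ a * b * hermForm σ H u v := by
  have h1 : σ ∘ (a • u) = σ a • (σ ∘ u) := by
    funext i
    simp
  rw [hermForm, hermForm, h1, mulVec_smul, smul_dotProduct, dotProduct_smul, smul_eq_mul, smul_eq_mul,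
    mul_assoc]

/-- Conjugate-linearity in the first variable over `ℂ`: `⟪c • u, v⟫ = c̄ ⟪u, v⟫`. [folklore] -/
private theorem hermForm_smul_left (Hc : Matrix m m ℂ) (c : ℂ) (u v : m → ℂ) :
    hermForm (starRingEnd ℂ) Hc (c • u) v = starRingEnd ℂ c * hermForm (starRingEnd ℂ) Hc u v := by
  simpa using hermForm_smul_smul_eq (starRingEnd ℂ) Hc c 1 u v

/-- Linearity in the second variable: `⟪u, c • v⟫ = c ⟪u, v⟫`. [folklore] -/
private theorem hermForm_smul_right (Hc : Matrix m m ℂ) (c : ℂ) (u v : m → ℂ) :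
    hermForm (starRingEnd ℂ) Hc u (c • v) = c * hermForm (starRingEnd ℂ) Hc u v := by
  simpa using hermForm_smul_smul_eq (starRingEnd ℂ) Hc 1 c u v

/-- Additivity in the second variable: `⟪u, v - v'⟫ = ⟪u, v⟫ - ⟪u, v'⟫`. [folklore] -/
private theorem hermForm_sub_right (Hc : Matrix m m ℂ) (u v v' : m → ℂ) :
    hermForm (starRingEnd ℂ) Hc u (v - v') =
      hermForm (starRingEnd ℂ) Hc u v - hermForm (starRingEnd ℂ) Hc u v' := by
  rw [hermForm_starRingEnd, hermForm_starRingEnd, hermForm_starRingEnd, mulVec_sub, dotProduct_sub]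

/-- Additivity in the first variable: `⟪u - u', v⟫ = ⟪u, v⟫ - ⟪u', v⟫`. [folklore] -/
private theorem hermForm_sub_left (Hc : Matrix m m ℂ) (u u' v : m → ℂ) :
    hermForm (starRingEnd ℂ) Hc (u - u') v =
      hermForm (starRingEnd ℂ) Hc u v - hermForm (starRingEnd ℂ) Hc u' v := by
  rw [hermForm_starRingEnd, hermForm_starRingEnd, hermForm_starRingEnd, star_sub, sub_dotProduct]

/-- **Hermitian symmetry**: `conj ⟪u, v⟫ = ⟪v, u⟫` for a hermitian Gram matrix. [folklore] -/
private theorem conj_hermForm {Hc : Matrix m m ℂ} (hH : Hc.IsHermitian) (u v : m → ℂ) :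
    starRingEnd ℂ (hermForm (starRingEnd ℂ) Hc u v) = hermForm (starRingEnd ℂ) Hc v u := by
  rw [hermForm_starRingEnd, hermForm_starRingEnd, starRingEnd_apply, ← star_dotProduct_star, star_star,
    star_mulVec, ← dotProduct_mulVec, hH.eq]

/-- A diagonal entry of a Sylvester frame identity: `⟪t_j, t_j⟫ = (Tᴴ H T)ⱼⱼ` for the `j`-th column
`t_j` of `T`. [folklore] -/
private theorem hermForm_col_col_eq (Hc T : Matrix m m ℂ) (j : m) :
    hermForm (starRingEnd ℂ) Hc (fun i ↦ T i j) (fun i ↦ T i j) = (Tᴴ * Hc * T) j j := by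
  rw [mul_mul_apply, hermForm_starRingEnd]
  have h1 : Tᴴ j = star fun i ↦ T i j := by
    funext i
    simp [conjTranspose_apply]
  have h2 : Tᵀ j = fun i ↦ T i j := rfl
  rw [h1, h2]

end Hermitian

/-! ### Signature `(p, 1)`: positive vectors, and negative vectors orthogonal to them -/

section Signature

variable {p : ℕ}

/-- The diagonal entries of `H_{p,1} = diag(1, …, 1, -1)`: `-1` in the last place, `1` elsewhere.
[cite: BergeronMillsonMoeglin2016Balls, Part 2 §1.1] -/
theorem signatureMatrix_apply_self (i : Fin (p + 1)) :
    signatureMatrix p i i = if i = Fin.last p then -1 else 1 := by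
  rw [signatureMatrix, diagonal_apply_eq]

/-- **The first frame vector is positive**: for a Sylvester frame `Tᴴ H T = diag(1,…,1,-1)` with
`p ≥ 1`, the column `t₀` has `⟪t₀, t₀⟫ = 1`. [cite: BergeronMillsonMoeglin2016Balls, Part 2 §1.1] -/
theorem hermForm_col_zero (hp : 0 < p) {Hc : Matrix (Fin (p + 1)) (Fin (p + 1)) ℂ}
    {T : Matrix (Fin (p + 1)) (Fin (p + 1)) ℂ} (hT : Tᴴ * Hc * T = signatureMatrix p) :
    hermForm (starRingEnd ℂ) Hc (fun i ↦ T i 0) (fun i ↦ T i 0) = 1 := by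
  have h0 : (0 : Fin (p + 1)) ≠ Fin.last p := fun h ↦ hp.ne (by simpa using congrArg Fin.val h)
  rw [hermForm_col_col_eq, hT, signatureMatrix_apply_self, if_neg h0]

/-- **The last frame vector is negative**: `⟪t_p, t_p⟫ = -1`.
[cite: BergeronMillsonMoeglin2016Balls, Part 2 §1.1] -/
theorem hermForm_col_last {Hc : Matrix (Fin (p + 1)) (Fin (p + 1)) ℂ}
    {T : Matrix (Fin (p + 1)) (Fin (p + 1)) ℂ} (hT : Tᴴ * Hc * T = signatureMatrix p) :
    hermForm (starRingEnd ℂ) Hc (fun i ↦ T i (Fin.last p)) (fun i ↦ T i (Fin.last p)) = -1 := by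
  rw [hermForm_col_col_eq, hT, signatureMatrix_apply_self, if_pos rfl]

/-- **A negative vector orthogonal to a positive one, in signature `(p, 1)`.** If `Hc` is hermitian
with a Sylvester frame `Tᴴ Hc T = diag(1,…,1,-1)` and `Re ⟪u, u⟫ > 0`, then some `v` in the negative
cone is orthogonal to `u`: with `t_p` the last frame column and `a = ⟪u, t_p⟫ / ⟪u, u⟫`, the vector
`v = t_p - a • u` has `⟪u, v⟫ = 0` and `⟪v, v⟫ = -1 - |a|² ⟪u, u⟫`. (The orthogonal complement of a
positive line in a space of signature `(p, 1)` has signature `(p - 1, 1)`; Kudla–Millson's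
`D_U = {Z ∈ D : Z ⊆ U^⊥}` is non-empty.) [cite: KudlaMillson1990, §2, pp. 129–131] -/
theorem exists_mem_negCone_hermForm_eq_zero {Hc : Matrix (Fin (p + 1)) (Fin (p + 1)) ℂ}
    (hH : Hc.IsHermitian) {T : Matrix (Fin (p + 1)) (Fin (p + 1)) ℂ}
    (hT : Tᴴ * Hc * T = signatureMatrix p) {u : Fin (p + 1) → ℂ}
    (hu : 0 < (hermForm (starRingEnd ℂ) Hc u u).re) :
    ∃ v ∈ negCone Hc, hermForm (starRingEnd ℂ) Hc u v = 0 := by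
  set t : Fin (p + 1) → ℂ := fun i ↦ T i (Fin.last p)
  set c : ℂ := hermForm (starRingEnd ℂ) Hc u u
  have hc0 : c ≠ 0 := fun h ↦ by
    rw [h, Complex.zero_re] at hu
    exact lt_irrefl _ hu
  set a : ℂ := hermForm (starRingEnd ℂ) Hc u t / c
  have hat : a * c = hermForm (starRingEnd ℂ) Hc u t := div_mul_cancel₀ _ hc0
  refine ⟨t - a • u, ?_, ?_⟩
  · -- `⟪v, v⟫ = -1 - |a|² ⟪u, u⟫`
    have huv : hermForm (starRingEnd ℂ) Hc u (t - a • u) = 0 := by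
      rw [hermForm_sub_right, hermForm_smul_right, hat, sub_self]
    have hvu : hermForm (starRingEnd ℂ) Hc (t - a • u) u = 0 := by
      rw [← conj_hermForm hH, huv, map_zero]
    have hvv : hermForm (starRingEnd ℂ) Hc (t - a • u) (t - a • u) =
        -1 - starRingEnd ℂ a * a * c := by
      rw [hermForm_sub_right, hermForm_smul_right, hvu, mul_zero, sub_zero, hermForm_sub_left,
        hermForm_smul_left, hermForm_col_last hT, ← hat, mul_assoc]
    show (hermForm (starRingEnd ℂ) Hc (t - a • u) (t - a • u)).re < 0
    rw [hvv, ← Complex.normSq_eq_conj_mul_self, Complex.sub_re, Complex.re_ofReal_mul, Complex.neg_re,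
      Complex.one_re]
    nlinarith [mul_nonneg (Complex.normSq_nonneg a) hu.le]
  · rw [hermForm_sub_right, hermForm_smul_right, hat, sub_self]

end Signature

/-! ### Totally positive lines exist -/

section TotallyPositive

variable (E : Subfield ℂ) [NumberField E] [IsCMField E] {p : ℕ}
  (H : Matrix (Fin (p + 1)) (Fin (p + 1)) E)

/-- **Positivity at every embedding from positivity at `τ₁`.** If `H` is positive definite at every
complex embedding off the place of `τ₁ = E.subtype` and `w ∈ E^{p+1}`, `w ≠ 0`, is positive at `τ₁`
(`Re ⟪τ₁ w, τ₁ w⟫ > 0`), then `Re τ⟪w, w⟫ > 0` for EVERY embedding `τ` (at the conjugate embedding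
`τ̄₁` because `Re conj z = Re z`). [cite: BergeronMillsonMoeglin2016Balls, Part 2 §1.1] -/
theorem re_embedding_hermForm_self_pos
    (hpos : ∀ τ : E →+* ℂ, InfinitePlace.mk τ ≠ InfinitePlace.mk E.subtype → (H.map τ).PosDef)
    {w : Fin (p + 1) → E} (hw : w ≠ 0)
    (h1 : 0 < (hermForm (starRingEnd ℂ) (H.map E.subtype) (E.subtype ∘ w) (E.subtype ∘ w)).re)
    (τ : E →+* ℂ) : 0 < (τ (hermForm (conjRingHom E) H w w)).re := by
  by_cases hτ : InfinitePlace.mk τ = InfinitePlace.mk E.subtype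
  · rcases InfinitePlace.mk_eq_iff.1 hτ with h | h
    · rw [h, map_hermForm E.subtype (embedding_conjRingHom E E.subtype)]
      exact h1
    · have hτ' : ∀ x, τ x = conj (E.subtype x) := fun x ↦ by
        rw [← h, ComplexEmbedding.conjugate_coe_eq, Complex.conj_conj]
      rw [hτ', Complex.conj_re, map_hermForm E.subtype (embedding_conjRingHom E E.subtype)]
      exact h1
  · have hne : τ ∘ w ≠ 0 := by
      obtain ⟨i, hi⟩ := Function.ne_iff.1 hw
      intro h
      exact hi (by simpa using congr_fun h i)
    have h2 := (hpos τ hτ).re_dotProduct_pos hne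
    rw [map_hermForm τ (embedding_conjRingHom E τ), hermForm_starRingEnd]
    simpa using h2

/-- **A positive vector spans a totally positive line**: with `H` definite off the place of `τ₁`, if
`w ≠ 0` is positive at `τ₁` then `E ∙ w` is totally positive definite (`⟪a w, a w⟫ = |a|² ⟪w, w⟫`).
[cite: BergeronMillsonMoeglin2016Balls, Introduction §1.7] -/
theorem isTotallyPositive_span_singleton
    (hpos : ∀ τ : E →+* ℂ, InfinitePlace.mk τ ≠ InfinitePlace.mk E.subtype → (H.map τ).PosDef)
    {w : Fin (p + 1) → E} (hw : w ≠ 0)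
    (h1 : 0 < (hermForm (starRingEnd ℂ) (H.map E.subtype) (E.subtype ∘ w) (E.subtype ∘ w)).re) :
    IsTotallyPositive (conjRingHom E) H (E ∙ w) := by
  intro w' hw' hne τ
  obtain ⟨a, rfl⟩ := Submodule.mem_span_singleton.1 hw'
  have ha : a ≠ 0 := by
    rintro rfl
    exact hne (zero_smul _ _)
  rw [hermForm_smul_smul_eq, map_mul, map_mul, embedding_conjRingHom, ← Complex.normSq_eq_conj_mul_self,
    Complex.re_ofReal_mul]
  exact mul_pos (Complex.normSq_pos.2 ((map_ne_zero τ).2 ha))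
    (re_embedding_hermForm_self_pos E H hpos hw h1 τ)

/-- **Totally positive lines exist.** Let `E ⊆ ℂ` be a CM field, `H` a Gram matrix on `E^{p+1}`,
`p ≥ 1`, with a Sylvester frame `Tᴴ H^{τ₁} T = diag(1,…,1,-1)` at the distinguished embedding and
positive definite at every other complex embedding. Then some `w ∈ E^{p+1}`, `w ≠ 0`, spans a totally
positive definite line `E ∙ w` — so the special cycles of codimension `1` of BMM §1.7 are indexed by a
non-empty family. (The positive cone at `τ₁` is open and contains the first frame vector; `E^{p+1}` is
dense in `ℂ^{p+1}`.) [cite: BergeronMillsonMoeglin2016Balls, Introduction §1.7] -/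
theorem exists_isTotallyPositive_span_singleton (hp : 0 < p)
    (hsig : ∃ T : GL (Fin (p + 1)) ℂ,
      (T : Matrix (Fin (p + 1)) (Fin (p + 1)) ℂ)ᴴ * H.map E.subtype *
        (T : Matrix (Fin (p + 1)) (Fin (p + 1)) ℂ) = signatureMatrix p)
    (hpos : ∀ τ : E →+* ℂ, InfinitePlace.mk τ ≠ InfinitePlace.mk E.subtype → (H.map τ).PosDef) :
    ∃ w : Fin (p + 1) → E, w ≠ 0 ∧ IsTotallyPositive (conjRingHom E) H (E ∙ w) := by
  obtain ⟨T, hT⟩ := hsig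
  -- the open positive cone at `τ₁`
  set O : Set (Fin (p + 1) → ℂ) :=
    {v | 0 < (hermForm (starRingEnd ℂ) (H.map E.subtype) v v).re} with hO_def
  have hO : IsOpen O :=
    isOpen_lt continuous_const (Complex.continuous_re.comp
      ((continuous_pi fun i ↦ (continuous_apply i).star).dotProduct
        (continuous_const.matrix_mulVec continuous_id)))
  -- it contains the first frame vector
  have ht : (fun i ↦ (T : Matrix (Fin (p + 1)) (Fin (p + 1)) ℂ) i 0) ∈ O := by
    show 0 < (hermForm (starRingEnd ℂ) (H.map E.subtype) _ _).re
    rw [hermForm_col_zero hp hT, Complex.one_re]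
    exact one_pos
  -- density of `E^{p+1}`
  obtain ⟨w, hwO⟩ := exists_coe_mem_of_isOpen E hO ⟨_, ht⟩
  have hw : w ≠ 0 := by
    rintro rfl
    have h0 : (fun _ : Fin (p + 1) ↦ ((0 : E) : ℂ)) = 0 := by
      funext i
      simp
    rw [hO_def, Set.mem_setOf_eq] at hwO
    simp only [Pi.zero_apply, h0, hermForm_starRingEnd, star_zero, zero_dotProduct,
      Complex.zero_re, lt_self_iff_false] at hwO
  exact ⟨w, hw, isTotallyPositive_span_singleton E H hpos hw hwO⟩

end TotallyPositive

/-! ### Complex points of non-empty Zariski-open subsets -/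

section Jacobson

open _root_.AlgebraicGeometry

/-- **A non-empty Zariski-open subset of a `ℂ`-scheme locally of finite type has a complex point**:
closed points are dense in the Jacobson space `X` (Mathlib `LocallyOfFiniteType.jacobsonSpace`,
`nonempty_inter_closedPoints`), and closed points are complex points by the Nullstellensatz
(`ComplexPoints.equivClosedPoints`): Görtz–Wedhorn, Prop. 3.35 (closed points are very dense) and
Cor. 3.36 (over an algebraically closed field the closed points are the `k`-valued points, and they are
very dense — Def. 3.34 (iv): every non-empty locally closed subset contains one).
[cite: GortzWedhorn2020, Prop. 3.35 and Cor. 3.36] -/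
theorem exists_pt_mem_of_isOpen {X : SchemeOver ℂ} [LocallyOfFiniteType X.hom] {U : Set X.left}
    (hU : IsOpen U) (hne : U.Nonempty) : ∃ P : ComplexPoints X, P.pt ∈ U := by
  haveI : JacobsonSpace X.left := LocallyOfFiniteType.jacobsonSpace X.hom
  obtain ⟨x, hxU, hxc⟩ := nonempty_inter_closedPoints hne hU.isLocallyClosed
  refine ⟨(ComplexPoints.equivClosedPoints X).symm ⟨x, hxc⟩, ?_⟩
  have h := ComplexPoints.coe_equivClosedPoints_apply X
    ((ComplexPoints.equivClosedPoints X).symm ⟨x, hxc⟩)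
  rw [Equiv.apply_symm_apply] at h
  rw [← h]
  exact hxU

end Jacobson

/-! ### Datum level: totally positive lines and their (non-empty) special sub-balls -/

namespace UnitaryBallUniformisationDatum

section AnyDimension

variable {p : ℕ} {X : SchemeOver ℂ} (D : UnitaryBallUniformisationDatum p X)

/-- **A ball-quotient datum of dimension `p ≥ 1` has a totally positive line** `W ⊆ V = E^{p+1}`,
`dim_E W = 1` — the family indexing the special cycles of codimension `1` (BMM §1.7, `n = 1`) is
non-empty. [cite: BergeronMillsonMoeglin2016Balls, Introduction §1.7] -/
theorem exists_isTotallyPositive_finrank_eq_one (hp : 0 < p) :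
    ∃ W : Submodule D.E (Fin (p + 1) → D.E),
      IsTotallyPositive (conjRingHom D.E) D.H W ∧ Module.finrank D.E W = 1 := by
  obtain ⟨w, hw, hW⟩ :=
    exists_isTotallyPositive_span_singleton D.E D.H hp D.signature_τ₁ D.posDef_of_ne
  exact ⟨D.E ∙ w, hW, finrank_span_singleton hw⟩

/-- **The sub-ball of a totally positive line is non-empty**: for `W ⊆ V` totally positive of
dimension `1`, the sub-cone `subCone H^{τ₁} (τ₁ W)` of negative vectors orthogonal to `τ₁(W)` — which
uniformises the special curve `c(W)` — contains a vector: a generator `w` of `W` is positive at `τ₁`,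
a negative vector orthogonal to `τ₁ w` exists in signature `(p, 1)`
(`exists_mem_negCone_hermForm_eq_zero`), and it is orthogonal to all of `τ₁(W) = τ₁(E) · τ₁ w` by
sesquilinearity (Kudla–Millson: `D_U ≠ ∅`). [cite: KudlaMillson1990, §2, pp. 129–131] -/
theorem subCone_nonempty_of_finrank_eq_one {W : Submodule D.E (Fin (p + 1) → D.E)}
    (hW : IsTotallyPositive (conjRingHom D.E) D.H W) (h1 : Module.finrank D.E W = 1) :
    (subCone D.Hℂ ((fun w ↦ D.τ₁ ∘ w) '' (W : Set (Fin (p + 1) → D.E)))).Nonempty := by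
  -- a non-zero vector of `W`, positive at `τ₁`
  have hW0 : W ≠ ⊥ := by
    intro h
    rw [h, finrank_bot] at h1
    exact zero_ne_one h1
  obtain ⟨w, hwW, hw0⟩ := Submodule.exists_mem_ne_zero_of_ne_bot hW0
  have hpos : 0 < (hermForm (starRingEnd ℂ) D.Hℂ (D.τ₁ ∘ w) (D.τ₁ ∘ w)).re := by
    rw [← map_hermForm D.τ₁ (embedding_conjRingHom D.E D.τ₁)]
    exact hW w hwW hw0 D.τ₁
  -- a negative vector orthogonal to it
  obtain ⟨T, hT⟩ := D.signature_τ₁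
  obtain ⟨v, hv, horth⟩ := exists_mem_negCone_hermForm_eq_zero D.isHermitian_Hℂ hT hpos
  refine ⟨v, hv, ?_⟩
  -- every vector of `W = E ∙ w` is an `E`-multiple of `w`
  rintro _ ⟨w', hw'W, rfl⟩
  obtain ⟨c, hc⟩ :=
    (finrank_eq_one_iff_of_nonzero' (⟨w, hwW⟩ : W) (by simpa using hw0)).1 h1 ⟨w', hw'W⟩
  have hc' : w' = c • w := by simpa using (congrArg Subtype.val hc).symm
  have hcomp : D.τ₁ ∘ (c • w) = (D.τ₁ c) • (D.τ₁ ∘ w) := by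
    funext i
    simp
  show hermForm (starRingEnd ℂ) D.Hℂ (D.τ₁ ∘ w') v = 0
  rw [hc', hcomp, hermForm_smul_left, horth, mul_zero]

/-- Hence the special curve `c(W) = unif '' subCone(τ₁ W)` of a totally positive line `W`, as a set of
complex points of `X`, is non-empty. [cite: BergeronMillsonMoeglin2016Balls, Introduction §1.7] -/
theorem image_unif_subCone_nonempty_of_finrank_eq_one {W : Submodule D.E (Fin (p + 1) → D.E)}
    (hW : IsTotallyPositive (conjRingHom D.E) D.H W) (h1 : Module.finrank D.E W = 1) :
    (D.unif '' subCone D.Hℂ ((fun w ↦ D.τ₁ ∘ w) '' (W : Set (Fin (p + 1) → D.E)))).Nonempty :=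
  (D.subCone_nonempty_of_finrank_eq_one hW h1).image _

end AnyDimension

/-! ### Dimension `2`: the special subvarieties supplied by `PicardCM.specialCyclesAlgebraic_holds` -/

section Surface

open _root_.AlgebraicGeometry

variable {X : SchemeOver ℂ} (D : UnitaryBallUniformisationDatum 2 X)

/-- The five uniformisation clauses of the datum, as the predicate `PicardCM.IsBallUniformisation` of
the Picard–CM prerequisite records (a repackaging of the datum's own fields: `S(Γ) = Γ\𝔹` is
uniformised by the ball of negative lines). [cite: BergeronMillsonMoeglin2016Balls, Introduction §1.1 and Part 2 §1.3] -/
theorem isBallUniformisation :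
    Literature.NumberTheory.Automorphic.PicardCM.IsBallUniformisation D.E D.H D.Γ X D.unif :=
  ⟨D.continuousOn_unif, D.isOpenMap_unif, D.surjOn_unif, D.unif_eq_unif_iff, D.differentiableOn_unif⟩

/-- **Special cycles of a uniformised compact ball quotient surface are proper**: for `W ≠ 0` totally
positive, the special cycle `unif '' subCone(τ₁ W)` misses a complex point of `X`. By the THEOREM
`PicardCM.specialCyclesAlgebraic_holds` (Kudla–Millson Lemma 1.1 p. 128 and p. 133, Chow) it is the set
of complex points of a Zariski-closed `Z ⊆ X` all of whose points have codimension `≥ dim_E W ≥ 1`; the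
generic point of the irreducible smooth projective surface `X` has codimension `0`, so `X ∖ Z` is a
non-empty open subset and has a complex point. [cite: KudlaMillson1990, Lemma 1.1, p. 128 and p. 133]
[cite: BergeronMillsonMoeglin2016Balls, Introduction §1.7] -/
theorem exists_pt_notMem_image_unif_subCone {W : Submodule D.E (Fin 3 → D.E)}
    (hW : IsTotallyPositive (conjRingHom D.E) D.H W) (hW0 : W ≠ ⊥) :
    ∃ P : ComplexPoints X,
      P ∉ D.unif '' subCone D.Hℂ ((fun w ↦ D.τ₁ ∘ w) '' (W : Set (Fin 3 → D.E))) := by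
  obtain ⟨Z, hZc, hZpt, hZcodim⟩ :=
    Literature.NumberTheory.Automorphic.PicardCM.specialCyclesAlgebraic_holds D.E D.H D.Γ X D.unif
      D.conj_H_apply D.anisotropic D.signature_τ₁ D.posDef_of_ne D.isCongruenceSubgroup D.torsionFree
      D.isSmoothProjective D.isBallUniformisation W hW
  have h1 : 1 ≤ Module.finrank D.E W :=
    Nat.one_le_iff_ne_zero.2 fun h ↦ hW0 (Submodule.finrank_eq_zero.1 h)
  obtain ⟨x, hx⟩ := HodgeTheory.exists_notMem_of_coheight D.isSmoothProjective hZcodim h1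
  haveI := D.isSmoothProjective.smoothOfRelativeDimension
  haveI : Smooth X.hom := SmoothOfRelativeDimension.smooth 2 X.hom
  obtain ⟨P, hP⟩ := exists_pt_mem_of_isOpen hZc.isOpen_compl ⟨x, hx⟩
  exact ⟨P, fun h ↦ hP ((hZpt P).2 h)⟩

/-- **Non-vacuity of the special-cycle record in codimension `1` (uniformisation datum form).** A
uniformised compact ball quotient surface `X(ℂ) ≅ Γ\𝔹²` carries a totally positive LINE `W ⊆ E³`
whose special curve `c(W) = unif '' subCone(τ₁ W)` is a non-empty set of complex points of `X` and is
not all of `X(ℂ)` (so the Zariski-closed special subvariety of `PicardCM.specialCyclesAlgebraic_holds`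
is a genuine curve: non-empty and proper). [cite: BergeronMillsonMoeglin2016Balls, Introduction §1.7]
[cite: KudlaMillson1990, Lemma 1.1, p. 128 and p. 133] -/
theorem exists_line_image_unif_subCone_nonempty_ne :
    ∃ W : Submodule D.E (Fin 3 → D.E), IsTotallyPositive (conjRingHom D.E) D.H W ∧
      Module.finrank D.E W = 1 ∧
      (D.unif '' subCone D.Hℂ ((fun w ↦ D.τ₁ ∘ w) '' (W : Set (Fin 3 → D.E)))).Nonempty ∧
      ∃ P : ComplexPoints X,
        P ∉ D.unif '' subCone D.Hℂ ((fun w ↦ D.τ₁ ∘ w) '' (W : Set (Fin 3 → D.E))) := by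
  obtain ⟨W, hW, h1⟩ := D.exists_isTotallyPositive_finrank_eq_one two_pos
  have hW0 : W ≠ ⊥ := by
    intro h
    rw [h, finrank_bot] at h1
    exact zero_ne_one h1
  exact ⟨W, hW, h1, D.image_unif_subCone_nonempty_of_finrank_eq_one hW h1,
    D.exists_pt_notMem_image_unif_subCone hW hW0⟩

end Surface

end UnitaryBallUniformisationDatum

/-! ### Datum level with special subvarieties: `UnitaryBallQuotientDatum` -/

namespace UnitaryBallQuotientDatum

open _root_.AlgebraicGeometry

variable {p : ℕ} {X : SchemeOver ℂ} (D : UnitaryBallQuotientDatum p X)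

/-- **The special curve of a totally positive line has complex points**: for `W ⊆ V` totally positive
of dimension `1` there is `P ∈ X(ℂ)` with `P.pt ∈ D.specialSubvariety W` (the complex points of the
special subvariety are the images of the non-empty sub-ball `𝔹(W^⊥)`).
[cite: BergeronMillsonMoeglin2016Balls, Introduction §1.7] -/
theorem exists_pt_mem_specialSubvariety {W : Submodule D.E (Fin (p + 1) → D.E)}
    (hW : IsTotallyPositive (conjRingHom D.E) D.H W) (h1 : Module.finrank D.E W = 1) :
    ∃ P : ComplexPoints X, P.pt ∈ D.specialSubvariety W := by
  obtain ⟨P, hP⟩ := D.image_unif_subCone_nonempty_of_finrank_eq_one hW h1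
  exact ⟨P, (D.pt_mem_specialSubvariety_iff W hW P).2 hP⟩

/-- **Special subvarieties of non-zero subspaces are proper**: for `W ≠ 0` totally positive,
`D.specialSubvariety W ≠ X` — its points have codimension `≥ dim_E W ≥ 1` (codimension clause of the
datum; BMM §1.7: complex codimension `n q = dim W`) while the generic point of the irreducible smooth
projective variety `X` has codimension `0`. [cite: BergeronMillsonMoeglin2016Balls, Introduction §1.7] -/
theorem specialSubvariety_ne_univ {W : Submodule D.E (Fin (p + 1) → D.E)}
    (hW : IsTotallyPositive (conjRingHom D.E) D.H W) (hW0 : W ≠ ⊥) :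
    D.specialSubvariety W ≠ Set.univ := by
  have h1 : 1 ≤ Module.finrank D.E W :=
    Nat.one_le_iff_ne_zero.2 fun h ↦ hW0 (Submodule.finrank_eq_zero.1 h)
  obtain ⟨x, hx⟩ := HodgeTheory.exists_notMem_of_coheight D.isSmoothProjective
    (D.le_coheight_of_mem_specialSubvariety W hW) h1
  exact fun h ↦ hx (h ▸ Set.mem_univ x)

/-- The complement of the special subvariety of a non-zero totally positive `W` has complex points:
some `P ∈ X(ℂ)` has `P.pt ∉ D.specialSubvariety W` (a non-empty Zariski-open subset of `X` has a
complex point). [cite: BergeronMillsonMoeglin2016Balls, Introduction §1.7] -/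
theorem exists_pt_notMem_specialSubvariety {W : Submodule D.E (Fin (p + 1) → D.E)}
    (hW : IsTotallyPositive (conjRingHom D.E) D.H W) (hW0 : W ≠ ⊥) :
    ∃ P : ComplexPoints X, P.pt ∉ D.specialSubvariety W := by
  have h1 : 1 ≤ Module.finrank D.E W :=
    Nat.one_le_iff_ne_zero.2 fun h ↦ hW0 (Submodule.finrank_eq_zero.1 h)
  obtain ⟨x, hx⟩ := HodgeTheory.exists_notMem_of_coheight D.isSmoothProjective
    (D.le_coheight_of_mem_specialSubvariety W hW) h1
  haveI := D.isSmoothProjective.smoothOfRelativeDimension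
  haveI : Smooth X.hom := SmoothOfRelativeDimension.smooth p X.hom
  exact exists_pt_mem_of_isOpen (D.isClosed_specialSubvariety W hW).isOpen_compl ⟨x, hx⟩

/-- **The `k = 1` non-vacuity package.** A compact connected Shimura variety of simple unitary type
`X(ℂ) ≅ Γ\𝔹ᵖ`, `p ≥ 1` (the datum `D`), carries a totally positive LINE `W ⊆ V = E^{p+1}`; its
special subvariety `D.specialSubvariety W` (the special curve `c(W)` for `p = 2`) has complex points and
is not all of `X`. In particular the special cycle classes of codimension `1`
(`specialCycleClasses D 1`) are indexed by a non-empty family of genuine proper subvarieties.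
[cite: BergeronMillsonMoeglin2016Balls, Introduction §1.7] [cite: KudlaMillson1990, §2, pp. 129–131] -/
theorem exists_isTotallyPositive_line_specialSubvariety_ne_univ (hp : 0 < p) :
    ∃ W : Submodule D.E (Fin (p + 1) → D.E), IsTotallyPositive (conjRingHom D.E) D.H W ∧
      Module.finrank D.E W = 1 ∧ (∃ P : ComplexPoints X, P.pt ∈ D.specialSubvariety W) ∧
        D.specialSubvariety W ≠ Set.univ := by
  obtain ⟨W, hW, h1⟩ := D.exists_isTotallyPositive_finrank_eq_one hp
  have hW0 : W ≠ ⊥ := by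
    intro h
    rw [h, finrank_bot] at h1
    exact zero_ne_one h1
  exact ⟨W, hW, h1, D.exists_pt_mem_specialSubvariety hW h1, D.specialSubvariety_ne_univ hW hW0⟩

/-- The surface case `p = 2` (Picard modular surfaces, Kudla–Millson / BMM with `q = 1`, `n = 1`): a
totally positive line exists and its special CURVE is a non-empty proper subvariety of `X`.
[cite: BergeronMillsonMoeglin2016Balls, Introduction §1.7] -/
theorem exists_specialCurve_nonempty_ne_univ {X₂ : SchemeOver ℂ} (D₂ : UnitaryBallQuotientDatum 2 X₂) :
    ∃ W : Submodule D₂.E (Fin 3 → D₂.E), IsTotallyPositive (conjRingHom D₂.E) D₂.H W ∧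
      Module.finrank D₂.E W = 1 ∧ (∃ P : ComplexPoints X₂, P.pt ∈ D₂.specialSubvariety W) ∧
        D₂.specialSubvariety W ≠ Set.univ :=
  D₂.exists_isTotallyPositive_line_specialSubvariety_ne_univ two_pos

end UnitaryBallQuotientDatum

/-!
## v2 (seat p15, 2026-08-21): `k = 2` — totally positive PLANES and special POINTS

Append-only sequel (row P-C4-04b of the foundations lane; v1 above is `k = 1`). Kudla–Millson, §2
pp. 129–131: for a positive definite rational `r`-plane `U` (`r ≤ p`) the cycle of definite type is
`C_U = Γ_U \ D_U`, `D_U = {Z ∈ D : Z ⊆ U^⊥}`; for the ball (`q = 1`) and `r = p` the symmetric space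
`D_U` of `U(U^⊥) ≅ U(0, 1)` is a POINT, and the special cycles of complex codimension `nq = p`
(BMM Introduction §1.7) are special POINTS of `S(Γ)` (0-dimensional special cycles). We prove that
they exist:

* `exists_hermForm_pos_hermForm_eq_zero` — in signature `(p, 1)` with `p ≥ 2`, every vector has a
  POSITIVE vector orthogonal to it (`α t₀ + β t₁` for the two positive frame columns);
* `exists_isTotallyPositive_finrank_eq_two` — for `p ≥ 2` a TOTALLY POSITIVE PLANE `W ⊆ E^{p+1}`,
  `dim_E W = 2`, exists: an orthogonal pair `w₁ ⊥ w₂` of vectors of `E^{p+1}` positive at `τ₁` (the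
  second one found by density in the `E`-rational hyperplane `w₁^⊥`, through the `E`-linear projection
  `y ↦ y - (⟪w₁, y⟫/⟪w₁, w₁⟫) w₁`), and `⟪a w₁ + b w₂, a w₁ + b w₂⟫ = |a|²⟪w₁, w₁⟫ + |b|²⟪w₂, w₂⟫`;
* `subCone_nonempty_of_finrank_eq_two` — on the SURFACE (`p = 2`): for `W` totally positive of
  dimension `2` (and `H` anisotropic), the `E`-line `W^⊥` is spanned by a vector NEGATIVE at `τ₁`
  (otherwise `⟪x, x⟫ ≥ 0` on the dense subset `τ₁(E³) ⊆ ℂ³`, contradicting the negative frame vector),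
  so the sub-ball `𝔹(W^⊥)` — a point — is non-empty;
* datum forms `UnitaryBallUniformisationDatum.exists_isTotallyPositive_finrank_eq_two` (`p ≥ 2`),
  `UnitaryBallQuotientDatum.exists_pt_mem_specialSubvariety_of_finrank_eq_two` and the package
  `UnitaryBallQuotientDatum.exists_specialPoints_nonempty_ne_univ` (`p = 2`): a totally positive plane
  exists, its special subvariety (codimension `≥ 2`: special points) has complex points and is not all
  of `X` — the index of `specialCycleClasses D 2` is non-empty.
-/

/-! ### More sesquilinear algebra (any commutative ring with involution) -/

section HermitianTwo

variable {R : Type*} [CommRing R] {m : Type*} [Fintype m]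

/-- Additivity in the second variable: `⟪u, v + v'⟫ = ⟪u, v⟫ + ⟪u, v'⟫`. [folklore] -/
private theorem hermForm_add_right' (σ : R →+* R) (H : Matrix m m R) (u v v' : m → R) :
    hermForm σ H u (v + v') = hermForm σ H u v + hermForm σ H u v' := by
  rw [hermForm, hermForm, hermForm, mulVec_add, dotProduct_add]

/-- Additivity in the first variable: `⟪u + u', v⟫ = ⟪u, v⟫ + ⟪u', v⟫`. [folklore] -/
private theorem hermForm_add_left' (σ : R →+* R) (H : Matrix m m R) (u u' v : m → R) :
    hermForm σ H (u + u') v = hermForm σ H u v + hermForm σ H u' v := by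
  have h1 : σ ∘ (u + u') = σ ∘ u + σ ∘ u' := by
    funext i
    simp
  rw [hermForm, hermForm, hermForm, h1, add_dotProduct]

/-- `⟪u, v - v'⟫ = ⟪u, v⟫ - ⟪u, v'⟫`. [folklore] -/
private theorem hermForm_sub_right' (σ : R →+* R) (H : Matrix m m R) (u v v' : m → R) :
    hermForm σ H u (v - v') = hermForm σ H u v - hermForm σ H u v' := by
  rw [hermForm, hermForm, hermForm, mulVec_sub, dotProduct_sub]

/-- `⟪u, c • v⟫ = c ⟪u, v⟫`. [folklore] -/
private theorem hermForm_smul_right' (σ : R →+* R) (H : Matrix m m R) (c : R) (u v : m → R) :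
    hermForm σ H u (c • v) = c * hermForm σ H u v := by
  simpa using hermForm_smul_smul_eq σ H 1 c u v

/-- `⟪c • u, v⟫ = σ(c) ⟪u, v⟫`. [folklore] -/
private theorem hermForm_smul_left' (σ : R →+* R) (H : Matrix m m R) (c : R) (u v : m → R) :
    hermForm σ H (c • u) v = σ c * hermForm σ H u v := by
  simpa using hermForm_smul_smul_eq σ H c 1 u v

/-- `⟪u, 0⟫ = 0`. [folklore] -/
private theorem hermForm_zero_right (σ : R →+* R) (H : Matrix m m R) (u : m → R) :
    hermForm σ H u 0 = 0 := by
  rw [hermForm, mulVec_zero, dotProduct_zero]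

/-- An entry of a frame identity: `⟪t_i, t_j⟫ = (Tᴴ H T)ᵢⱼ` for the columns `t_i`, `t_j` of `T`.
[folklore] -/
private theorem hermForm_col_col (Hc T : Matrix m m ℂ) (i j : m) :
    hermForm (starRingEnd ℂ) Hc (fun k ↦ T k i) (fun k ↦ T k j) = (Tᴴ * Hc * T) i j := by
  rw [mul_mul_apply, hermForm_starRingEnd]
  have h1 : Tᴴ i = star fun k ↦ T k i := by
    funext k
    simp [conjTranspose_apply]
  have h2 : Tᵀ j = fun k ↦ T k j := rfl
  rw [h1, h2]

/-- The pairing with a fixed vector, `x ↦ ⟪u, x⟫`, as an `R`-linear functional (the form is linear in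
its second variable). [folklore] -/
private theorem exists_linearMap_hermForm (σ : R →+* R) (H : Matrix m m R) (u : m → R) :
    ∃ ℓ : (m → R) →ₗ[R] R, ∀ x, ℓ x = hermForm σ H u x :=
  ⟨{ toFun := fun x ↦ hermForm σ H u x
     map_add' := fun x y ↦ hermForm_add_right' σ H u x y
     map_smul' := fun c x ↦ by
       rw [hermForm_smul_right', RingHom.id_apply, smul_eq_mul] }, fun _ ↦ rfl⟩

end HermitianTwo

/-! ### Signature `(p, 1)`, `p ≥ 2`: positive vectors orthogonal to a given one -/

section SignatureTwo

variable {p : ℕ}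

/-- Off-diagonal entries of `H_{p,1} = diag(1, …, 1, -1)` vanish.
[cite: BergeronMillsonMoeglin2016Balls, Part 2 §1.1] -/
theorem signatureMatrix_apply_ne {i j : Fin (p + 1)} (h : i ≠ j) : signatureMatrix p i j = 0 := by
  rw [signatureMatrix, diagonal_apply_ne _ h]

/-- **A positive vector orthogonal to a given vector, in signature `(p, 1)` with `p ≥ 2`.** For a
Sylvester frame `Tᴴ Hc T = diag(1,…,1,-1)` and any `u`, some `x` with `Re ⟪x, x⟫ > 0` has `⟪u, x⟫ = 0`:
`x = ⟪u, t₁⟫ t₀ - ⟪u, t₀⟫ t₁` for the two positive orthonormal frame columns `t₀`, `t₁` (or `x = t₀`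
when `⟪u, t₀⟫ = 0`), `⟪x, x⟫ = |⟪u, t₁⟫|² + |⟪u, t₀⟫|²`. (The orthogonal complement of a line in a
space of signature `(p, 1)`, `p ≥ 2`, contains positive vectors.)
[cite: BergeronMillsonMoeglin2016Balls, Part 2 §1.1] -/
theorem exists_hermForm_pos_hermForm_eq_zero (hp : 2 ≤ p) {Hc : Matrix (Fin (p + 1)) (Fin (p + 1)) ℂ}
    {T : Matrix (Fin (p + 1)) (Fin (p + 1)) ℂ} (hT : Tᴴ * Hc * T = signatureMatrix p)
    (u : Fin (p + 1) → ℂ) :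
    ∃ x : Fin (p + 1) → ℂ,
      0 < (hermForm (starRingEnd ℂ) Hc x x).re ∧ hermForm (starRingEnd ℂ) Hc u x = 0 := by
  -- the two positive frame columns
  set i₁ : Fin (p + 1) := ⟨1, by omega⟩ with hi₁_def
  have h01 : (0 : Fin (p + 1)) ≠ i₁ := fun h ↦ by simpa [hi₁_def] using congrArg Fin.val h
  have h0l : (0 : Fin (p + 1)) ≠ Fin.last p := fun h ↦ by
    have := congrArg Fin.val h
    simp at this
    omega
  have h1l : i₁ ≠ Fin.last p := fun h ↦ by
    have := congrArg Fin.val h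
    simp [hi₁_def] at this
    omega
  set t₀ : Fin (p + 1) → ℂ := fun k ↦ T k 0
  set t₁ : Fin (p + 1) → ℂ := fun k ↦ T k i₁
  have h00 : hermForm (starRingEnd ℂ) Hc t₀ t₀ = 1 := by
    rw [hermForm_col_col, hT, signatureMatrix_apply_self, if_neg h0l]
  have h11 : hermForm (starRingEnd ℂ) Hc t₁ t₁ = 1 := by
    rw [hermForm_col_col, hT, signatureMatrix_apply_self, if_neg h1l]
  have h01' : hermForm (starRingEnd ℂ) Hc t₀ t₁ = 0 := by
    rw [hermForm_col_col, hT, signatureMatrix_apply_ne h01]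
  have h10' : hermForm (starRingEnd ℂ) Hc t₁ t₀ = 0 := by
    rw [hermForm_col_col, hT, signatureMatrix_apply_ne h01.symm]
  by_cases hu0 : hermForm (starRingEnd ℂ) Hc u t₀ = 0
  · exact ⟨t₀, by rw [h00, Complex.one_re]; exact one_pos, hu0⟩
  · -- `x = ⟪u, t₁⟫ t₀ - ⟪u, t₀⟫ t₁`
    set α : ℂ := hermForm (starRingEnd ℂ) Hc u t₁
    set β : ℂ := hermForm (starRingEnd ℂ) Hc u t₀
    refine ⟨α • t₀ + (-β) • t₁, ?_, ?_⟩
    · have hxx : hermForm (starRingEnd ℂ) Hc (α • t₀ + (-β) • t₁) (α • t₀ + (-β) • t₁) =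
          starRingEnd ℂ α * α + starRingEnd ℂ β * β := by
        rw [hermForm_add_right', hermForm_add_left', hermForm_add_left', hermForm_smul_smul_eq,
          hermForm_smul_smul_eq, hermForm_smul_smul_eq, hermForm_smul_smul_eq, h00, h11, h01', h10',
          map_neg]
        ring
      rw [hxx, ← Complex.normSq_eq_conj_mul_self, ← Complex.normSq_eq_conj_mul_self, Complex.add_re,
        Complex.ofReal_re, Complex.ofReal_re]
      exact add_pos_of_nonneg_of_pos (Complex.normSq_nonneg _) (Complex.normSq_pos.2 hu0)
    · rw [hermForm_add_right', hermForm_smul_right, hermForm_smul_right]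
      ring

end SignatureTwo

/-! ### Totally positive planes exist (`p ≥ 2`) -/

section TotallyPositiveTwo

variable (E : Subfield ℂ) [NumberField E] [IsCMField E] {p : ℕ}
  (H : Matrix (Fin (p + 1)) (Fin (p + 1)) E)

/-- A hermitian Gram matrix stays hermitian at every complex embedding (`τ ∘ σ = conj ∘ τ`).
[cite: BergeronMillsonMoeglin2016Balls, Part 2 §1.1] -/
theorem isHermitian_map_embedding (hH : ∀ i j, conjRingHom E (H i j) = H j i) (τ : E →+* ℂ) :
    (H.map τ).IsHermitian :=
  Matrix.IsHermitian.ext fun i j ↦ by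
    change star (τ (H j i)) = τ (H i j)
    rw [Complex.star_def, ← embedding_conjRingHom, hH]

/-- **Hermitian symmetry over `E`**: `σ ⟪u, v⟫ = ⟪v, u⟫` for a hermitian Gram matrix (checked at the
embedding `τ₁`, which is injective). [cite: BergeronMillsonMoeglin2016Balls, Part 2 §1.1] -/
theorem conjRingHom_hermForm (hH : ∀ i j, conjRingHom E (H i j) = H j i) (u v : Fin (p + 1) → E) :
    conjRingHom E (hermForm (conjRingHom E) H u v) = hermForm (conjRingHom E) H v u := by
  apply E.subtype.injective
  rw [embedding_conjRingHom, map_hermForm E.subtype (embedding_conjRingHom E E.subtype),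
    map_hermForm E.subtype (embedding_conjRingHom E E.subtype)]
  exact conj_hermForm (isHermitian_map_embedding E H hH E.subtype) _ _

/-- **An orthogonal pair of positive vectors spans a totally positive plane**: if `w₁ ⊥ w₂` are
non-zero vectors of `E^{p+1}`, each positive at `τ₁` (`H` hermitian, definite off the place of `τ₁`),
then `⟪a w₁ + b w₂, a w₁ + b w₂⟫ = |a|² ⟪w₁, w₁⟫ + |b|² ⟪w₂, w₂⟫` is totally positive on the span `W` of
`w₁, w₂`, and `dim_E W = 2`. [cite: BergeronMillsonMoeglin2016Balls, Introduction §1.7] -/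
theorem isTotallyPositive_span_pair (hH : ∀ i j, conjRingHom E (H i j) = H j i)
    (hpos : ∀ τ : E →+* ℂ, InfinitePlace.mk τ ≠ InfinitePlace.mk E.subtype → (H.map τ).PosDef)
    {w₁ w₂ : Fin (p + 1) → E} (hw₁ : w₁ ≠ 0) (hw₂ : w₂ ≠ 0)
    (h₁ : 0 < (hermForm (starRingEnd ℂ) (H.map E.subtype) (E.subtype ∘ w₁) (E.subtype ∘ w₁)).re)
    (h₂ : 0 < (hermForm (starRingEnd ℂ) (H.map E.subtype) (E.subtype ∘ w₂) (E.subtype ∘ w₂)).re)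
    (horth : hermForm (conjRingHom E) H w₁ w₂ = 0) :
    IsTotallyPositive (conjRingHom E) H (Submodule.span E (Set.range ![w₁, w₂])) ∧
      Module.finrank E (Submodule.span E (Set.range ![w₁, w₂])) = 2 := by
  have horth' : hermForm (conjRingHom E) H w₂ w₁ = 0 := by
    rw [← conjRingHom_hermForm E H hH, horth, map_zero]
  have hc₁ : hermForm (conjRingHom E) H w₁ w₁ ≠ 0 := by
    intro h
    have h' := h₁
    rw [← map_hermForm E.subtype (embedding_conjRingHom E E.subtype), h, map_zero, Complex.zero_re] at h'
    exact lt_irrefl _ h'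
  refine ⟨?_, ?_⟩
  · intro w hw hne τ
    obtain ⟨c, rfl⟩ := (Submodule.mem_span_range_iff_exists_fun E).1 hw
    have hsum : (∑ i, c i • (![w₁, w₂] : Fin 2 → Fin (p + 1) → E) i) = c 0 • w₁ + c 1 • w₂ := by
      simp [Fin.sum_univ_two]
    rw [hsum] at hne ⊢
    have key : hermForm (conjRingHom E) H (c 0 • w₁ + c 1 • w₂) (c 0 • w₁ + c 1 • w₂) =
        conjRingHom E (c 0) * c 0 * hermForm (conjRingHom E) H w₁ w₁ +
          conjRingHom E (c 1) * c 1 * hermForm (conjRingHom E) H w₂ w₂ := by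
      rw [hermForm_add_right', hermForm_add_left', hermForm_add_left', hermForm_smul_smul_eq,
        hermForm_smul_smul_eq, hermForm_smul_smul_eq, hermForm_smul_smul_eq, horth, horth']
      ring
    rw [key]
    simp only [map_add, map_mul, embedding_conjRingHom]
    rw [← Complex.normSq_eq_conj_mul_self, ← Complex.normSq_eq_conj_mul_self, Complex.add_re,
      Complex.re_ofReal_mul, Complex.re_ofReal_mul]
    have hp₁ := re_embedding_hermForm_self_pos E H hpos hw₁ h₁ τ
    have hp₂ := re_embedding_hermForm_self_pos E H hpos hw₂ h₂ τ
    by_cases h0 : c 0 = 0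
    · have h1' : c 1 ≠ 0 := by
        intro h1
        apply hne
        simp [h0, h1]
      rw [h0, map_zero, Complex.normSq_zero, zero_mul, zero_add]
      exact mul_pos (Complex.normSq_pos.2 ((map_ne_zero τ).2 h1')) hp₂
    · exact add_pos_of_pos_of_nonneg (mul_pos (Complex.normSq_pos.2 ((map_ne_zero τ).2 h0)) hp₁)
        (mul_nonneg (Complex.normSq_nonneg _) hp₂.le)
  · have hli : LinearIndependent E ![w₁, w₂] := by
      refine LinearIndependent.pair_iff.2 fun s t hst ↦ ?_
      have hs' : s * hermForm (conjRingHom E) H w₁ w₁ = 0 := by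
        have h := congrArg (hermForm (conjRingHom E) H w₁) hst
        rwa [hermForm_add_right', hermForm_smul_right', hermForm_smul_right', horth, mul_zero, add_zero,
          hermForm_zero_right] at h
      have hs : s = 0 := (mul_eq_zero.1 hs').resolve_right hc₁
      refine ⟨hs, ?_⟩
      rw [hs, zero_smul, zero_add] at hst
      exact (smul_eq_zero.1 hst).resolve_right hw₂
    rw [finrank_span_eq_card hli, Fintype.card_fin]

/-- **Totally positive planes exist.** Let `E ⊆ ℂ` be a CM field and `H` a hermitian Gram matrix on
`E^{p+1}`, `p ≥ 2`, with a Sylvester frame of signature `(p, 1)` at `τ₁` and positive definite at the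
other complex embeddings. Then there is a totally positive definite `E`-subspace `W ⊆ E^{p+1}` of
dimension `2` — so the special cycles of codimension `2` (BMM §1.7, `n = 2`; for `p = 2` the special
POINTS) are indexed by a non-empty family. Construction: a first positive vector `w₁`
(`exists_isTotallyPositive_span_singleton`), then a positive vector of the `E`-hyperplane `w₁^⊥`, found
by density of `E^{p+1}` near a positive complex vector of `(τ₁ w₁)^⊥` through the `E`-rational projection
`y ↦ y - (⟪w₁, y⟫ / ⟪w₁, w₁⟫) w₁`. [cite: BergeronMillsonMoeglin2016Balls, Introduction §1.7] -/
theorem exists_isTotallyPositive_finrank_eq_two (hp : 2 ≤ p)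
    (hH : ∀ i j, conjRingHom E (H i j) = H j i)
    (hsig : ∃ T : GL (Fin (p + 1)) ℂ,
      (T : Matrix (Fin (p + 1)) (Fin (p + 1)) ℂ)ᴴ * H.map E.subtype *
        (T : Matrix (Fin (p + 1)) (Fin (p + 1)) ℂ) = signatureMatrix p)
    (hpos : ∀ τ : E →+* ℂ, InfinitePlace.mk τ ≠ InfinitePlace.mk E.subtype → (H.map τ).PosDef) :
    ∃ W : Submodule E (Fin (p + 1) → E),
      IsTotallyPositive (conjRingHom E) H W ∧ Module.finrank E W = 2 := by
  -- a first positive vector `w₁`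
  obtain ⟨w₁, hw₁, hW₁⟩ := exists_isTotallyPositive_span_singleton E H (by omega) hsig hpos
  have h₁E := hW₁ w₁ (Submodule.mem_span_singleton_self w₁) hw₁ E.subtype
  have h₁ : 0 < (hermForm (starRingEnd ℂ) (H.map E.subtype) (E.subtype ∘ w₁) (E.subtype ∘ w₁)).re := by
    rw [← map_hermForm E.subtype (embedding_conjRingHom E E.subtype)]
    exact h₁E
  have hc₁ : hermForm (conjRingHom E) H w₁ w₁ ≠ 0 := by
    intro h
    rw [h, map_zero, Complex.zero_re] at h₁E
    exact lt_irrefl _ h₁E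
  obtain ⟨T, hT⟩ := hsig
  set Hc : Matrix (Fin (p + 1)) (Fin (p + 1)) ℂ := H.map E.subtype with hHc
  set u₁ : Fin (p + 1) → ℂ := E.subtype ∘ w₁ with hu₁
  set c₁ : ℂ := hermForm (starRingEnd ℂ) Hc u₁ u₁ with hc₁_def
  -- a positive complex vector orthogonal to `u₁ = τ₁ w₁`
  obtain ⟨x₀, hx₀, hx₀orth⟩ := exists_hermForm_pos_hermForm_eq_zero hp hT u₁
  -- the complexified projection onto `u₁^⊥`, and the open set of vectors with positive projection
  set πc : (Fin (p + 1) → ℂ) → (Fin (p + 1) → ℂ) :=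
    fun x ↦ x - (hermForm (starRingEnd ℂ) Hc u₁ x / c₁) • u₁ with hπc
  have hπc_cont : Continuous πc := by
    refine continuous_id.sub ((Continuous.div_const ?_ c₁).smul continuous_const)
    exact continuous_const.dotProduct (continuous_const.matrix_mulVec continuous_id)
  set O : Set (Fin (p + 1) → ℂ) := {v | 0 < (hermForm (starRingEnd ℂ) Hc v v).re} with hO_def
  have hO : IsOpen O :=
    isOpen_lt continuous_const (Complex.continuous_re.comp
      ((continuous_pi fun i ↦ (continuous_apply i).star).dotProduct
        (continuous_const.matrix_mulVec continuous_id)))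
  have hx₀O : x₀ ∈ πc ⁻¹' O := by
    have hfix : πc x₀ = x₀ := by
      simp only [hπc, hx₀orth, zero_div, zero_smul, sub_zero]
    show 0 < (hermForm (starRingEnd ℂ) Hc (πc x₀) (πc x₀)).re
    rw [hfix]
    exact hx₀
  -- density of `E^{p+1}`: an `E`-vector `y` with positive projection
  obtain ⟨y, hy⟩ := exists_coe_mem_of_isOpen E (hO.preimage hπc_cont) ⟨x₀, hx₀O⟩
  -- its `E`-rational projection `w₂ ∈ w₁^⊥`
  set w₂ : Fin (p + 1) → E :=
    y - (hermForm (conjRingHom E) H w₁ y / hermForm (conjRingHom E) H w₁ w₁) • w₁ with hw₂_def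
  have horth : hermForm (conjRingHom E) H w₁ w₂ = 0 := by
    rw [hw₂_def, hermForm_sub_right', hermForm_smul_right', div_mul_cancel₀ _ hc₁, sub_self]
  have hcomp : E.subtype ∘ w₂ = πc (E.subtype ∘ y) := by
    have e1 : E.subtype (hermForm (conjRingHom E) H w₁ y) =
        hermForm (starRingEnd ℂ) Hc u₁ (E.subtype ∘ y) :=
      map_hermForm E.subtype (embedding_conjRingHom E E.subtype) H w₁ y
    have e2 : E.subtype (hermForm (conjRingHom E) H w₁ w₁) = c₁ :=
      map_hermForm E.subtype (embedding_conjRingHom E E.subtype) H w₁ w₁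
    funext i
    simp only [hπc, hw₂_def, hu₁, Function.comp_apply, Pi.sub_apply, Pi.smul_apply, smul_eq_mul,
      map_sub, map_mul, map_div₀, e1, e2]
  have h₂ : 0 < (hermForm (starRingEnd ℂ) Hc (E.subtype ∘ w₂) (E.subtype ∘ w₂)).re := by
    rw [hcomp]
    exact hy
  have hw₂ : w₂ ≠ 0 := by
    intro h
    have h0 : E.subtype ∘ (0 : Fin (p + 1) → E) = 0 := by
      funext i
      simp
    have h' := h₂
    rw [h, h0, hermForm_starRingEnd, star_zero, zero_dotProduct, Complex.zero_re] at h'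
    exact lt_irrefl _ h'
  obtain ⟨hW, hfin⟩ := isTotallyPositive_span_pair E H hH hpos hw₁ hw₂ h₁ h₂ horth
  exact ⟨_, hW, hfin⟩

end TotallyPositiveTwo

/-! ### The surface: the sub-ball of a totally positive plane is a (non-empty) point -/

section SpecialPoints

variable (E : Subfield ℂ) [NumberField E] [IsCMField E] (H : Matrix (Fin 3) (Fin 3) E)

/-- **The sub-ball `𝔹(W^⊥)` of a totally positive PLANE `W ⊆ E³` is non-empty** (`H` hermitian,
anisotropic, of signature `(2, 1)` at `τ₁`): the `E`-line `W^⊥` is spanned by a vector `u` which is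
NEGATIVE at `τ₁`, so `τ₁ u ∈ subCone H^{τ₁} (τ₁ W)` — Kudla–Millson's `D_U = {Z ∈ D : Z ⊆ U^⊥}` for
`dim U = p = 2` is the point `U^⊥ ⊗ ℂ`. Proof: `u ≠ 0` orthogonal to a basis of `W` exists by a
dimension count; `W = u^⊥` (dimension count, `⟪u, u⟫ ≠ 0` by anisotropy); if `Re ⟪τ₁u, τ₁u⟫ ≥ 0` then,
writing `x = x' + c u` with `x' ∈ W`, `Re τ₁⟪x, x⟫ = Re τ₁⟪x', x'⟫ + |τ₁ c|² Re τ₁⟪u, u⟫ ≥ 0` for every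
`x ∈ E³`, which is absurd since the open negative cone contains `E`-points (density).
[cite: KudlaMillson1990, §2, pp. 129–131] -/
theorem subCone_nonempty_of_finrank_eq_two (hH : ∀ i j, conjRingHom E (H i j) = H j i)
    (han : ∀ v : Fin 3 → E, hermForm (conjRingHom E) H v v = 0 → v = 0)
    (hsig : ∃ T : GL (Fin 3) ℂ,
      (T : Matrix (Fin 3) (Fin 3) ℂ)ᴴ * H.map E.subtype * (T : Matrix (Fin 3) (Fin 3) ℂ) =
        signatureMatrix 2)
    {W : Submodule E (Fin 3 → E)} (hW : IsTotallyPositive (conjRingHom E) H W)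
    (h2 : Module.finrank E W = 2) :
    (subCone (H.map E.subtype) ((fun w ↦ E.subtype ∘ w) '' (W : Set (Fin 3 → E)))).Nonempty := by
  -- a basis `w₁, w₂` of `W`
  let b := Module.finBasisOfFinrankEq E W h2
  set w₁ : Fin 3 → E := (b 0 : Fin 3 → E) with hw₁_def
  set w₂ : Fin 3 → E := (b 1 : Fin 3 → E) with hw₂_def
  -- a non-zero `u` orthogonal to `w₁` and `w₂` (dimension count `2 + 2 > 3`)
  obtain ⟨ℓ₁, hℓ₁⟩ := exists_linearMap_hermForm (conjRingHom E) H w₁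
  obtain ⟨ℓ₂, hℓ₂⟩ := exists_linearMap_hermForm (conjRingHom E) H w₂
  have hker : ∀ ℓ : (Fin 3 → E) →ₗ[E] E, 2 ≤ Module.finrank E (LinearMap.ker ℓ) := fun ℓ ↦ by
    have h := ℓ.finrank_range_add_finrank_ker
    rw [Module.finrank_fin_fun] at h
    have hr : Module.finrank E (LinearMap.range ℓ) ≤ 1 := by
      simpa using (LinearMap.range ℓ).finrank_le
    omega
  have hinf : LinearMap.ker ℓ₁ ⊓ LinearMap.ker ℓ₂ ≠ ⊥ := by
    intro h
    have hdim := Submodule.finrank_sup_add_finrank_inf_eq (LinearMap.ker ℓ₁) (LinearMap.ker ℓ₂)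
    rw [h, finrank_bot] at hdim
    have hsup : Module.finrank E ↥(LinearMap.ker ℓ₁ ⊔ LinearMap.ker ℓ₂) ≤ 3 := by
      simpa using (LinearMap.ker ℓ₁ ⊔ LinearMap.ker ℓ₂).finrank_le
    have hk₁ := hker ℓ₁
    have hk₂ := hker ℓ₂
    omega
  obtain ⟨u, hu, hu0⟩ := Submodule.exists_mem_ne_zero_of_ne_bot hinf
  obtain ⟨hu₁, hu₂⟩ := Submodule.mem_inf.1 hu
  have hu₁' : hermForm (conjRingHom E) H w₁ u = 0 := by
    rw [← hℓ₁ u]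
    exact LinearMap.mem_ker.1 hu₁
  have hu₂' : hermForm (conjRingHom E) H w₂ u = 0 := by
    rw [← hℓ₂ u]
    exact LinearMap.mem_ker.1 hu₂
  -- every vector of `W` is orthogonal to `u`
  have hWu : ∀ w ∈ W, hermForm (conjRingHom E) H w u = 0 := by
    intro w hw
    have hrepr : (⟨w, hw⟩ : W) = b.repr ⟨w, hw⟩ 0 • b 0 + b.repr ⟨w, hw⟩ 1 • b 1 := by
      conv_lhs => rw [← b.sum_repr ⟨w, hw⟩, Fin.sum_univ_two]
    have hw' : w = b.repr ⟨w, hw⟩ 0 • w₁ + b.repr ⟨w, hw⟩ 1 • w₂ := by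
      have h := congrArg Subtype.val hrepr
      simpa [hw₁_def, hw₂_def] using h
    rw [hw', hermForm_add_left', hermForm_smul_left', hermForm_smul_left', hu₁', hu₂', mul_zero,
      mul_zero, add_zero]
  have huu : hermForm (conjRingHom E) H u u ≠ 0 := fun h ↦ hu0 (han u h)
  obtain ⟨T, hT⟩ := hsig
  -- `u` is negative at `τ₁`
  have hneg : (hermForm (starRingEnd ℂ) (H.map E.subtype) (E.subtype ∘ u) (E.subtype ∘ u)).re < 0 := by
    by_contra hnn
    rw [not_lt] at hnn
    -- `W = u^⊥`
    obtain ⟨ℓ, hℓ⟩ := exists_linearMap_hermForm (conjRingHom E) H u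
    have hWle : W ≤ LinearMap.ker ℓ := fun w hw ↦ by
      rw [LinearMap.mem_ker, hℓ, ← conjRingHom_hermForm E H hH, hWu w hw, map_zero]
    have hker_ne : LinearMap.ker ℓ ≠ ⊤ := by
      intro h
      have hmem : u ∈ LinearMap.ker ℓ := h ▸ Submodule.mem_top
      rw [LinearMap.mem_ker, hℓ] at hmem
      exact huu hmem
    have hWeq : W = LinearMap.ker ℓ := by
      refine Submodule.eq_of_le_of_finrank_le hWle ?_
      have hlt := Submodule.finrank_lt_finrank_of_lt (lt_top_iff_ne_top.2 hker_ne)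
      rw [finrank_top, Module.finrank_fin_fun] at hlt
      omega
    -- hence `Re τ₁⟪x, x⟫ ≥ 0` for every `x ∈ E³`
    have hnonneg : ∀ x : Fin 3 → E, 0 ≤ (E.subtype (hermForm (conjRingHom E) H x x)).re := by
      intro x
      set c : E := hermForm (conjRingHom E) H u x / hermForm (conjRingHom E) H u u with hc
      set x' : Fin 3 → E := x - c • u with hx'
      have hux' : hermForm (conjRingHom E) H u x' = 0 := by
        rw [hx', hermForm_sub_right', hermForm_smul_right', hc, div_mul_cancel₀ _ huu, sub_self]
      have hx'W : x' ∈ W := by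
        rw [hWeq, LinearMap.mem_ker, hℓ]
        exact hux'
      have hx'u : hermForm (conjRingHom E) H x' u = 0 := by
        rw [← conjRingHom_hermForm E H hH, hux', map_zero]
      have hxdecomp : x = x' + c • u := by
        rw [hx', sub_add_cancel]
      have key : hermForm (conjRingHom E) H x x =
          hermForm (conjRingHom E) H x' x' + conjRingHom E c * c * hermForm (conjRingHom E) H u u := by
        conv_lhs => rw [hxdecomp]
        rw [hermForm_add_right', hermForm_add_left', hermForm_add_left', hermForm_smul_smul_eq,
          hermForm_smul_left', hermForm_smul_right', hx'u, hux']
        ring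
      rw [key, map_add, map_mul, map_mul, embedding_conjRingHom, ← Complex.normSq_eq_conj_mul_self,
        Complex.add_re, Complex.re_ofReal_mul]
      refine add_nonneg ?_ (mul_nonneg (Complex.normSq_nonneg _) ?_)
      · by_cases hx'0 : x' = 0
        · rw [hx'0, hermForm_zero_right, map_zero, Complex.zero_re]
        · exact (hW x' hx'W hx'0 E.subtype).le
      · rwa [map_hermForm E.subtype (embedding_conjRingHom E E.subtype)]
    -- but the (open) negative cone contains an `E`-point
    have hne : (negCone (H.map E.subtype)).Nonempty :=
      ⟨fun k ↦ (T : Matrix (Fin 3) (Fin 3) ℂ) k (Fin.last 2), by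
        show (hermForm (starRingEnd ℂ) (H.map E.subtype) _ _).re < 0
        rw [hermForm_col_last hT]
        norm_num⟩
    obtain ⟨y, hy⟩ := exists_coe_mem_of_isOpen E (isOpen_negCone _) hne
    have hy' := hnonneg y
    rw [map_hermForm E.subtype (embedding_conjRingHom E E.subtype)] at hy'
    exact absurd hy (not_lt.2 hy')
  -- so `τ₁ u` lies in the sub-cone of `W`
  refine ⟨E.subtype ∘ u, hneg, ?_⟩
  rintro _ ⟨w, hw, rfl⟩
  show hermForm (starRingEnd ℂ) (H.map E.subtype) (E.subtype ∘ w) (E.subtype ∘ u) = 0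
  rw [← map_hermForm E.subtype (embedding_conjRingHom E E.subtype), hWu w hw, map_zero]

end SpecialPoints

/-! ### Datum level, `k = 2` -/

namespace UnitaryBallUniformisationDatum

/-- **A ball-quotient datum of dimension `p ≥ 2` has a totally positive PLANE** `W ⊆ V`, `dim_E W = 2`
(the family indexing the special cycles of codimension `2` is non-empty).
[cite: BergeronMillsonMoeglin2016Balls, Introduction §1.7] -/
theorem exists_isTotallyPositive_finrank_eq_two {p : ℕ} {X : SchemeOver ℂ}
    (D : UnitaryBallUniformisationDatum p X) (hp : 2 ≤ p) :
    ∃ W : Submodule D.E (Fin (p + 1) → D.E),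
      IsTotallyPositive (conjRingHom D.E) D.H W ∧ Module.finrank D.E W = 2 :=
  _root_.Literature.AlgebraicGeometry.ShimuraVarieties.exists_isTotallyPositive_finrank_eq_two D.E D.H
    hp D.conj_H_apply D.signature_τ₁ D.posDef_of_ne

/-- **On the surface, the sub-ball of a totally positive plane is non-empty**: for
`D : UnitaryBallUniformisationDatum 2 X` and `W ⊆ E³` totally positive of dimension `2`, the sub-cone
`subCone H^{τ₁} (τ₁ W)` (a punctured negative line: the special POINT of `W`) contains a vector.
[cite: KudlaMillson1990, §2, pp. 129–131] -/
theorem subCone_nonempty_of_finrank_eq_two {X : SchemeOver ℂ} (D : UnitaryBallUniformisationDatum 2 X)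
    {W : Submodule D.E (Fin 3 → D.E)} (hW : IsTotallyPositive (conjRingHom D.E) D.H W)
    (h2 : Module.finrank D.E W = 2) :
    (subCone D.Hℂ ((fun w ↦ D.τ₁ ∘ w) '' (W : Set (Fin 3 → D.E)))).Nonempty :=
  _root_.Literature.AlgebraicGeometry.ShimuraVarieties.subCone_nonempty_of_finrank_eq_two D.E D.H
    D.conj_H_apply D.anisotropic D.signature_τ₁ hW h2

/-- Hence the special point set `unif '' subCone(τ₁ W)` of a totally positive plane `W` is a non-empty
set of complex points of the surface. [cite: BergeronMillsonMoeglin2016Balls, Introduction §1.7] -/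
theorem image_unif_subCone_nonempty_of_finrank_eq_two {X : SchemeOver ℂ}
    (D : UnitaryBallUniformisationDatum 2 X) {W : Submodule D.E (Fin 3 → D.E)}
    (hW : IsTotallyPositive (conjRingHom D.E) D.H W) (h2 : Module.finrank D.E W = 2) :
    (D.unif '' subCone D.Hℂ ((fun w ↦ D.τ₁ ∘ w) '' (W : Set (Fin 3 → D.E)))).Nonempty :=
  (D.subCone_nonempty_of_finrank_eq_two hW h2).image _

end UnitaryBallUniformisationDatum

namespace UnitaryBallQuotientDatum

/-- **Special points exist**: for `D : UnitaryBallQuotientDatum 2 X` and `W ⊆ E³` totally positive of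
dimension `2`, some complex point `P` of `X` lies on the special subvariety `D.specialSubvariety W`
(whose points have codimension `≥ 2`: the 0-dimensional special cycle of the Picard modular surface
attached to `W`). [cite: BergeronMillsonMoeglin2016Balls, Introduction §1.7] [cite: KudlaMillson1990, §2, pp. 129–131] -/
theorem exists_pt_mem_specialSubvariety_of_finrank_eq_two {X : SchemeOver ℂ}
    (D : UnitaryBallQuotientDatum 2 X) {W : Submodule D.E (Fin 3 → D.E)}
    (hW : IsTotallyPositive (conjRingHom D.E) D.H W) (h2 : Module.finrank D.E W = 2) :
    ∃ P : ComplexPoints X, P.pt ∈ D.specialSubvariety W := by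
  obtain ⟨P, hP⟩ := D.image_unif_subCone_nonempty_of_finrank_eq_two hW h2
  exact ⟨P, (D.pt_mem_specialSubvariety_iff W hW P).2 hP⟩

/-- **The `k = 2` non-vacuity package (surface).** A compact Picard-type surface `X(ℂ) ≅ Γ\𝔹²`
(the datum `D`) carries a totally positive PLANE `W ⊆ E³`; its special subvariety
`D.specialSubvariety W` — of codimension `≥ 2`, the special points of `W` — has complex points and
is not all of `X`. In particular the special cycle classes of codimension `2`
(`specialCycleClasses D 2`) are indexed by a non-empty family of genuine proper subvarieties.
[cite: BergeronMillsonMoeglin2016Balls, Introduction §1.7] [cite: KudlaMillson1990, §2, pp. 129–131] -/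
theorem exists_specialPoints_nonempty_ne_univ {X : SchemeOver ℂ} (D : UnitaryBallQuotientDatum 2 X) :
    ∃ W : Submodule D.E (Fin 3 → D.E), IsTotallyPositive (conjRingHom D.E) D.H W ∧
      Module.finrank D.E W = 2 ∧ (∃ P : ComplexPoints X, P.pt ∈ D.specialSubvariety W) ∧
        D.specialSubvariety W ≠ Set.univ := by
  obtain ⟨W, hW, h2⟩ := D.exists_isTotallyPositive_finrank_eq_two le_rfl
  have hW0 : W ≠ ⊥ := by
    intro h
    rw [h, finrank_bot] at h2
    omega
  exact ⟨W, hW, h2, D.exists_pt_mem_specialSubvariety_of_finrank_eq_two hW h2,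
    D.specialSubvariety_ne_univ hW hW0⟩

end UnitaryBallQuotientDatum

/-!
## v3 (seat p15, 2026-08-21): EVERY codimension `0 ≤ k ≤ p`

Append-only sequel to v1 (`k = 1`) and v2 (`k = 2`). Bergeron–Millson–Moeglin, Part 2 §3.1: "Let `n`
be an integer `0 ≤ n ≤ p`. … as a sub-Hermitian space `U ⊂ V` is totally positive definite of
dimension `t`. In particular: `0 ≤ t ≤ p` … we can realize the symmetric space `X` as the set of
negative `q`-planes in `V_{v₀}`. We then let `X_H` be the subset of `X` consisting of those `q`-planes
which lie in `U^⊥_{v₀}`"; Kudla–Millson 1990, §2 p. 131: "In case `s = 0`, then `U` is a positive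
`r`-plane (so `r ≤ p`) and `D_U = {Z ∈ D : Z ⊂ U^⊥}`." The tree has the bound `dim_E W ≤ p` for a
totally positive `W` (`UnitaryBallUniformisationDatum.finrank_le_of_isTotallyPositive`, whence
`specialCycleClasses D k = ⊥` for `k > p`). Here we prove the CONVERSE and the non-emptiness of every
sub-ball:

* `exists_hermForm_pos_forall_hermForm_eq_zero` — in signature `(p, 1)`, any `k < p` vectors have a
  POSITIVE vector orthogonal to all of them (a non-zero solution of `k` linear equations in the span of
  the `k + 1` positive orthonormal frame columns `t₀, …, t_k`: kernel count);
* `exists_mem_negCone_forall_hermForm_eq_zero` — an orthogonal family of positive vectors `u₁, …, u_k`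
  has a NEGATIVE vector orthogonal to all of them: `v = t_p - Σᵢ (⟪uᵢ, t_p⟫ / ⟪uᵢ, uᵢ⟫) uᵢ`,
  `⟪v, v⟫ = -1 - Σᵢ |⟪uᵢ, t_p⟫|² / ⟪uᵢ, uᵢ⟫` (Kudla–Millson's `D_U ≠ ∅`: the orthogonal complement of a
  positive definite `k`-space in signature `(p, 1)` has signature `(p - k, 1)`);
* `exists_pos_forall_hermForm_eq_zero` / `exists_orthogonal_pos_family` — over the CM field `E ⊆ ℂ`:
  an orthogonal family of `k < p` vectors of `E^{p+1}` positive at `τ₁` extends by one (density of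
  `E^{p+1} ⊆ ℂ^{p+1}` through the `E`-linear projection `y ↦ y - Σᵢ (⟪wᵢ, y⟫ / ⟪wᵢ, wᵢ⟫) wᵢ`), so
  orthogonal `τ₁`-positive families of every size `k ≤ p` exist;
* `isTotallyPositive_span_of_orthogonal` — such a family spans a totally positive definite subspace
  of dimension `k` (`⟪Σ cᵢ wᵢ, Σ cᵢ wᵢ⟫ = Σ |cᵢ|² ⟪wᵢ, wᵢ⟫` at every embedding); hence
  `exists_isTotallyPositive_finrank_eq (hk : k ≤ p)` — TOTALLY POSITIVE SUBSPACES OF EVERY DIMENSION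
  `k ≤ p` EXIST — and, at datum level, `exists_isTotallyPositive_finrank_eq_iff : (∃ W, …) ↔ k ≤ p`;
* `subCone_nonempty_of_isTotallyPositive` — for EVERY totally positive `W` the sub-cone
  `subCone H^{τ₁} (τ₁ W)` (uniformising `𝔹(W^⊥)`, Kudla–Millson's `D_W`) is non-empty (Gram–Schmidt
  inside `W`, where `⟪w, w⟫ ≠ 0` by total positivity, then the negative vector above);
* datum packages: `UnitaryBallUniformisationDatum.subCone_nonempty_of_isTotallyPositive`,
  `UnitaryBallQuotientDatum.exists_pt_mem_specialSubvariety_of_isTotallyPositive` (EVERY special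
  subvariety has complex points), `specialSubvariety_bot_eq_univ` (`k = 0` gives all of `X`), and
  `exists_specialSubvariety_nonempty_ne_univ_iff` — a totally positive `W` of dimension `k` whose special
  subvariety is non-empty on complex points and proper exists IFF `1 ≤ k ≤ p`: the index family of
  `specialCycleClasses D k` consists of genuine proper non-empty subvarieties exactly in the range of
  BMM's `SC^{2k}`, `1 ≤ k ≤ p`.
-/

/-! ### Finite sums under the form; orthogonal families -/

section HermitianThree

variable {R : Type*} [CommRing R] {m : Type*} [Fintype m]

/-- `⟪0, v⟫ = 0`. [folklore] -/
private theorem hermForm_zero_left (σ : R →+* R) (H : Matrix m m R) (v : m → R) :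
    hermForm σ H 0 v = 0 := by
  have h0 : σ ∘ (0 : m → R) = 0 := funext fun i ↦ by simp
  rw [hermForm, h0, zero_dotProduct]

/-- Additivity in the second variable over a finite sum: `⟪u, Σ vᵢ⟫ = Σ ⟪u, vᵢ⟫`. [folklore] -/
private theorem hermForm_sum_right (σ : R →+* R) (H : Matrix m m R) (u : m → R) {ι : Type*}
    (s : Finset ι) (v : ι → m → R) :
    hermForm σ H u (∑ i ∈ s, v i) = ∑ i ∈ s, hermForm σ H u (v i) := by
  obtain ⟨ℓ, hℓ⟩ := exists_linearMap_hermForm σ H u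
  simp only [← hℓ, map_sum]

/-- Additivity in the first variable over a finite sum: `⟪Σ uᵢ, v⟫ = Σ ⟪uᵢ, v⟫`. [folklore] -/
private theorem hermForm_sum_left (σ : R →+* R) (H : Matrix m m R) {ι : Type*} (s : Finset ι)
    (u : ι → m → R) (v : m → R) :
    hermForm σ H (∑ i ∈ s, u i) v = ∑ i ∈ s, hermForm σ H (u i) v := by
  classical
  induction s using Finset.induction_on with
  | empty => rw [Finset.sum_empty, Finset.sum_empty, hermForm_zero_left]
  | insert a s ha ih => rw [Finset.sum_insert ha, Finset.sum_insert ha, hermForm_add_left', ih]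

/-- **The form on combinations of an orthogonal family**: if `w₁, …, w_k` are pairwise orthogonal then
`⟪Σ cᵢ wᵢ, Σ dᵢ wᵢ⟫ = Σᵢ σ(cᵢ) dᵢ ⟪wᵢ, wᵢ⟫`. [folklore] -/
private theorem hermForm_sum_smul_sum_smul (σ : R →+* R) (H : Matrix m m R) {k : ℕ}
    {w : Fin k → m → R} (horth : ∀ i j, i ≠ j → hermForm σ H (w i) (w j) = 0)
    (c d : Fin k → R) :
    hermForm σ H (∑ i, c i • w i) (∑ i, d i • w i) =
      ∑ i, σ (c i) * d i * hermForm σ H (w i) (w i) := by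
  rw [hermForm_sum_right]
  refine Finset.sum_congr rfl fun j _ ↦ ?_
  rw [hermForm_smul_right', hermForm_sum_left, Finset.sum_eq_single j]
  · rw [hermForm_smul_left']
    ring
  · intro i _ hij
    rw [hermForm_smul_left', horth i j hij, mul_zero]
  · intro h
    exact absurd (Finset.mem_univ j) h

/-- Pairing a combination of an orthogonal family with one of its members: `⟪w_j, Σ cᵢ wᵢ⟫ = c_j ⟪w_j, w_j⟫`.
[folklore] -/
private theorem hermForm_self_sum_smul (σ : R →+* R) (H : Matrix m m R) {k : ℕ}
    {w : Fin k → m → R} (horth : ∀ i j, i ≠ j → hermForm σ H (w i) (w j) = 0)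
    (c : Fin k → R) (j : Fin k) :
    hermForm σ H (w j) (∑ i, c i • w i) = c j * hermForm σ H (w j) (w j) := by
  rw [hermForm_sum_right, Finset.sum_eq_single j, hermForm_smul_right']
  · intro i _ hij
    rw [hermForm_smul_right', horth j i (Ne.symm hij), mul_zero]
  · intro h
    exact absurd (Finset.mem_univ j) h

end HermitianThree

/-! ### Signature `(p, 1)`: orthogonal complements of positive definite subspaces -/

section SignatureThree

variable {p : ℕ}

/-- The frame columns off the last one are orthonormal: `⟪t_i, t_j⟫ = δᵢⱼ` for `i ≠ last`.
[cite: BergeronMillsonMoeglin2016Balls, Part 2 §1.1] -/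
private theorem hermForm_col_col_of_ne_last {Hc T : Matrix (Fin (p + 1)) (Fin (p + 1)) ℂ}
    (hT : Tᴴ * Hc * T = signatureMatrix p) {i j : Fin (p + 1)} (hi : i ≠ Fin.last p) :
    hermForm (starRingEnd ℂ) Hc (fun r ↦ T r i) (fun r ↦ T r j) = if i = j then 1 else 0 := by
  rw [hermForm_col_col, hT]
  by_cases hij : i = j
  · subst hij
    rw [signatureMatrix_apply_self, if_neg hi, if_pos rfl]
  · rw [signatureMatrix_apply_ne hij, if_neg hij]

/-- **A positive vector orthogonal to `k < p` given vectors, in signature `(p, 1)`.** For a Sylvester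
frame `Tᴴ Hc T = diag(1, …, 1, -1)` and any vectors `u₁, …, u_k` with `k < p`, some `x` with
`Re ⟪x, x⟫ > 0` is orthogonal to every `uᵢ`: the `k` linear conditions `⟪uᵢ, Σⱼ aⱼ tⱼ⟫ = 0` on a
combination of the `k + 1` positive orthonormal frame columns `t₀, …, t_k` have a non-zero solution
(`k + 1 > k` unknowns), and `⟪Σ aⱼ tⱼ, Σ aⱼ tⱼ⟫ = Σ |aⱼ|² > 0`. (The orthogonal complement of a
`k`-dimensional subspace of a space of signature `(p, 1)`, `k < p`, contains positive vectors; this is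
the step `t < p ⇒` one more positive direction of BMM Part 2 §3.1, `0 ≤ t ≤ p`.)
[cite: BergeronMillsonMoeglin2016Balls, Part 2 §§1.1, 3.1] -/
theorem exists_hermForm_pos_forall_hermForm_eq_zero {k : ℕ} (hk : k < p)
    {Hc : Matrix (Fin (p + 1)) (Fin (p + 1)) ℂ} {T : Matrix (Fin (p + 1)) (Fin (p + 1)) ℂ}
    (hT : Tᴴ * Hc * T = signatureMatrix p) (u : Fin k → Fin (p + 1) → ℂ) :
    ∃ x : Fin (p + 1) → ℂ,
      0 < (hermForm (starRingEnd ℂ) Hc x x).re ∧ ∀ i, hermForm (starRingEnd ℂ) Hc (u i) x = 0 := by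
  -- the first `k + 1` frame columns: positive and orthonormal
  let ι : Fin (k + 1) → Fin (p + 1) := fun j ↦ ⟨j, by omega⟩
  have hι_inj : Function.Injective ι := fun j j' h ↦ Fin.ext (by simpa [ι] using congrArg Fin.val h)
  have hι_ne : ∀ j, ι j ≠ Fin.last p := fun j h ↦ by
    have h' := congrArg Fin.val h
    simp only [ι, Fin.val_last] at h'
    omega
  set t : Fin (k + 1) → Fin (p + 1) → ℂ := fun j r ↦ T r (ι j) with ht_def
  have htt : ∀ j j', hermForm (starRingEnd ℂ) Hc (t j) (t j') = if j = j' then 1 else 0 := by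
    intro j j'
    have h := hermForm_col_col_of_ne_last (j := ι j') hT (hι_ne j)
    simp only [hι_inj.eq_iff] at h
    exact h
  have htorth : ∀ j j', j ≠ j' → hermForm (starRingEnd ℂ) Hc (t j) (t j') = 0 := fun j j' h ↦ by
    rw [htt, if_neg h]
  -- `k` linear conditions on `k + 1` unknowns
  choose ℓ hℓ using fun i ↦ exists_linearMap_hermForm (starRingEnd ℂ) Hc (u i)
  let L : (Fin (k + 1) → ℂ) →ₗ[ℂ] (Fin k → ℂ) :=
    LinearMap.pi fun i ↦ (ℓ i).comp (Fintype.linearCombination ℂ t)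
  have hL : ∀ a i, L a i = hermForm (starRingEnd ℂ) Hc (u i) (∑ j, a j • t j) := fun a i ↦ by
    simp only [L, LinearMap.pi_apply, LinearMap.comp_apply, Fintype.linearCombination_apply, hℓ]
  have hker : LinearMap.ker L ≠ ⊥ := LinearMap.ker_ne_bot_of_finrank_lt (by simp)
  obtain ⟨a, ha, ha0⟩ := Submodule.exists_mem_ne_zero_of_ne_bot hker
  refine ⟨∑ j, a j • t j, ?_, fun i ↦ ?_⟩
  · rw [hermForm_sum_smul_sum_smul (starRingEnd ℂ) Hc htorth]
    simp only [htt, if_pos, mul_one, ← Complex.normSq_eq_conj_mul_self]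
    rw [← Complex.ofReal_sum, Complex.ofReal_re]
    obtain ⟨j₀, hj₀⟩ : ∃ j, a j ≠ 0 := by
      by_contra h
      exact ha0 (funext fun j ↦ Classical.byContradiction fun hj ↦ h ⟨j, hj⟩)
    exact Finset.sum_pos' (fun j _ ↦ Complex.normSq_nonneg _)
      ⟨j₀, Finset.mem_univ _, Complex.normSq_pos.2 hj₀⟩
  · rw [← hL, LinearMap.mem_ker.1 ha, Pi.zero_apply]

/-- **A negative vector orthogonal to an orthogonal family of positive vectors, in signature `(p, 1)`.**
If `Hc` is hermitian with a Sylvester frame `Tᴴ Hc T = diag(1, …, 1, -1)` and `u₁, …, u_k` are pairwise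
orthogonal with `Re ⟪uᵢ, uᵢ⟫ > 0`, then some `v` in the negative cone is orthogonal to every `uᵢ`:
with `t_p` the last frame column and `aᵢ = ⟪uᵢ, t_p⟫ / ⟪uᵢ, uᵢ⟫`, the vector `v = t_p - Σ aᵢ uᵢ` has
`⟪uᵢ, v⟫ = 0` and `⟪v, v⟫ = -1 - Σ |aᵢ|² ⟪uᵢ, uᵢ⟫`. (The orthogonal complement of a positive definite
subspace in signature `(p, 1)` contains negative lines: Kudla–Millson's symmetric space
`D_U = {Z ∈ D : Z ⊂ U^⊥}` of the definite cycle `C_U` is non-empty; BMM's `X_H` = the negative lines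
lying in `U^⊥_{v₀}`.) [cite: KudlaMillson1990, §2, p. 131] [cite: BergeronMillsonMoeglin2016Balls, Part 2 §3.1] -/
theorem exists_mem_negCone_forall_hermForm_eq_zero {Hc : Matrix (Fin (p + 1)) (Fin (p + 1)) ℂ}
    (hH : Hc.IsHermitian) {T : Matrix (Fin (p + 1)) (Fin (p + 1)) ℂ}
    (hT : Tᴴ * Hc * T = signatureMatrix p) {k : ℕ} {u : Fin k → Fin (p + 1) → ℂ}
    (hu : ∀ i, 0 < (hermForm (starRingEnd ℂ) Hc (u i) (u i)).re)
    (horth : ∀ i j, i ≠ j → hermForm (starRingEnd ℂ) Hc (u i) (u j) = 0) :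
    ∃ v ∈ negCone Hc, ∀ i, hermForm (starRingEnd ℂ) Hc (u i) v = 0 := by
  set t : Fin (p + 1) → ℂ := fun r ↦ T r (Fin.last p)
  have hc0 : ∀ i, hermForm (starRingEnd ℂ) Hc (u i) (u i) ≠ 0 := fun i h ↦ by
    have h' := hu i
    rw [h, Complex.zero_re] at h'
    exact lt_irrefl _ h'
  -- the coefficients `aᵢ = ⟪uᵢ, t⟫ / ⟪uᵢ, uᵢ⟫`
  set a : Fin k → ℂ := fun i ↦
    hermForm (starRingEnd ℂ) Hc (u i) t / hermForm (starRingEnd ℂ) Hc (u i) (u i) with ha_def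
  have hat : ∀ i, a i * hermForm (starRingEnd ℂ) Hc (u i) (u i) = hermForm (starRingEnd ℂ) Hc (u i) t :=
    fun i ↦ div_mul_cancel₀ _ (hc0 i)
  -- `v = t - Σ aᵢ uᵢ` is orthogonal to every `u_j`
  have huv : ∀ j, hermForm (starRingEnd ℂ) Hc (u j) (t - ∑ i, a i • u i) = 0 := fun j ↦ by
    rw [hermForm_sub_right, hermForm_self_sum_smul (starRingEnd ℂ) Hc horth a j, hat, sub_self]
  refine ⟨t - ∑ i, a i • u i, ?_, huv⟩
  -- `⟪v, v⟫ = ⟪t, v⟫ = -1 - Σ |aᵢ|² conj ⟪uᵢ, uᵢ⟫`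
  have hsv : hermForm (starRingEnd ℂ) Hc (∑ i, a i • u i) (t - ∑ i, a i • u i) = 0 := by
    rw [hermForm_sum_left, Finset.sum_eq_zero]
    intro i _
    rw [hermForm_smul_left, huv i, mul_zero]
  have htu : ∀ i, hermForm (starRingEnd ℂ) Hc t (u i) =
      starRingEnd ℂ (a i) * starRingEnd ℂ (hermForm (starRingEnd ℂ) Hc (u i) (u i)) := fun i ↦ by
    rw [← conj_hermForm hH (u i) t, ← hat i, map_mul]
  have hvv : hermForm (starRingEnd ℂ) Hc (t - ∑ i, a i • u i) (t - ∑ i, a i • u i) =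
      -1 - ∑ i, (Complex.normSq (a i) : ℂ) * starRingEnd ℂ (hermForm (starRingEnd ℂ) Hc (u i) (u i)) := by
    rw [hermForm_sub_left, hsv, sub_zero, hermForm_sub_right, hermForm_col_last hT, hermForm_sum_right]
    congr 1
    refine Finset.sum_congr rfl fun i _ ↦ ?_
    rw [hermForm_smul_right, htu i, Complex.normSq_eq_conj_mul_self]
    ring
  show (hermForm (starRingEnd ℂ) Hc (t - ∑ i, a i • u i) (t - ∑ i, a i • u i)).re < 0
  rw [hvv, Complex.sub_re, Complex.neg_re, Complex.one_re, Complex.re_sum]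
  have hnn : 0 ≤ ∑ i, ((Complex.normSq (a i) : ℂ) *
      starRingEnd ℂ (hermForm (starRingEnd ℂ) Hc (u i) (u i))).re :=
    Finset.sum_nonneg fun i _ ↦ by
      rw [Complex.re_ofReal_mul, Complex.conj_re]
      exact mul_nonneg (Complex.normSq_nonneg _) (hu i).le
  linarith

end SignatureThree

/-! ### Over the CM field: orthogonal positive families of every size `k ≤ p` -/

section TotallyPositiveThree

variable (E : Subfield ℂ) [NumberField E] [IsCMField E] {p : ℕ}
  (H : Matrix (Fin (p + 1)) (Fin (p + 1)) E)

/-- A vector positive at `τ₁` has `⟪w, w⟫ ≠ 0` in `E`. [folklore] -/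
private theorem hermForm_self_ne_zero_of_pos {w : Fin (p + 1) → E}
    (h : 0 < (hermForm (starRingEnd ℂ) (H.map E.subtype) (E.subtype ∘ w) (E.subtype ∘ w)).re) :
    hermForm (conjRingHom E) H w w ≠ 0 := by
  intro h0
  rw [← map_hermForm E.subtype (embedding_conjRingHom E E.subtype), h0, map_zero, Complex.zero_re] at h
  exact lt_irrefl _ h

omit [NumberField E] [IsCMField E] in
/-- A vector positive at `τ₁` is non-zero. [folklore] -/
private theorem ne_zero_of_pos {w : Fin (p + 1) → E}
    (h : 0 < (hermForm (starRingEnd ℂ) (H.map E.subtype) (E.subtype ∘ w) (E.subtype ∘ w)).re) :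
    w ≠ 0 := by
  rintro rfl
  have h0 : E.subtype ∘ (0 : Fin (p + 1) → E) = 0 := funext fun i ↦ by simp
  rw [h0, hermForm_starRingEnd, star_zero, zero_dotProduct, Complex.zero_re] at h
  exact lt_irrefl _ h

/-- **An orthogonal family of positive vectors spans a totally positive subspace of the right
dimension.** If `w₁, …, w_k ∈ E^{p+1}` are pairwise orthogonal and each positive at `τ₁` (`H` hermitian,
positive definite off the place of `τ₁`), then `⟪Σ cᵢ wᵢ, Σ cᵢ wᵢ⟫ = Σ |cᵢ|² ⟪wᵢ, wᵢ⟫` has positive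
real part at every complex embedding unless all `cᵢ = 0`, so the span `W` is totally positive
definite; and the `wᵢ` are linearly independent (pair a vanishing combination with `w_j`), so
`dim_E W = k`. [cite: BergeronMillsonMoeglin2016Balls, Introduction §1.7 and Part 2 §3.1] -/
theorem isTotallyPositive_span_of_orthogonal
    (hpos : ∀ τ : E →+* ℂ, InfinitePlace.mk τ ≠ InfinitePlace.mk E.subtype → (H.map τ).PosDef)
    {k : ℕ} {w : Fin k → Fin (p + 1) → E}
    (hw : ∀ i, 0 < (hermForm (starRingEnd ℂ) (H.map E.subtype) (E.subtype ∘ w i) (E.subtype ∘ w i)).re)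
    (horth : ∀ i j, i ≠ j → hermForm (conjRingHom E) H (w i) (w j) = 0) :
    IsTotallyPositive (conjRingHom E) H (Submodule.span E (Set.range w)) ∧
      Module.finrank E (Submodule.span E (Set.range w)) = k := by
  have hne : ∀ i, w i ≠ 0 := fun i ↦ ne_zero_of_pos E H (hw i)
  have hc : ∀ i, hermForm (conjRingHom E) H (w i) (w i) ≠ 0 := fun i ↦
    hermForm_self_ne_zero_of_pos E H (hw i)
  refine ⟨?_, ?_⟩
  · intro v hv hv0 τ
    obtain ⟨c, rfl⟩ := (Submodule.mem_span_range_iff_exists_fun E).1 hv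
    obtain ⟨i₀, hi₀⟩ : ∃ i, c i ≠ 0 := by
      by_contra h
      apply hv0
      have h' : ∀ i, c i = 0 := fun i ↦ Classical.byContradiction fun hi ↦ h ⟨i, hi⟩
      simp [h']
    rw [hermForm_sum_smul_sum_smul (conjRingHom E) H horth]
    simp only [map_sum, map_mul, embedding_conjRingHom, ← Complex.normSq_eq_conj_mul_self]
    rw [Complex.re_sum]
    simp only [Complex.re_ofReal_mul]
    exact Finset.sum_pos'
      (fun i _ ↦ mul_nonneg (Complex.normSq_nonneg _)
        (re_embedding_hermForm_self_pos E H hpos (hne i) (hw i) τ).le)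
      ⟨i₀, Finset.mem_univ _, mul_pos (Complex.normSq_pos.2 ((map_ne_zero τ).2 hi₀))
        (re_embedding_hermForm_self_pos E H hpos (hne i₀) (hw i₀) τ)⟩
  · have hli : LinearIndependent E w := by
      refine Fintype.linearIndependent_iff.2 fun g hg j ↦ ?_
      have h := congrArg (hermForm (conjRingHom E) H (w j)) hg
      rw [hermForm_zero_right, hermForm_self_sum_smul (conjRingHom E) H horth g j] at h
      exact (mul_eq_zero.1 h).resolve_right (hc j)
    rw [finrank_span_eq_card hli, Fintype.card_fin]

/-- **Extending an orthogonal positive family** (`k < p`). Let `E ⊆ ℂ` be a CM field and `H` a hermitian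
Gram matrix on `E^{p+1}` with a Sylvester frame of signature `(p, 1)` at `τ₁`. If `w₁, …, w_k ∈ E^{p+1}`,
`k < p`, are pairwise orthogonal and positive at `τ₁`, there is `w' ∈ E^{p+1}` positive at `τ₁` and
orthogonal to every `wᵢ`: a positive complex vector `x₀ ∈ (τ₁ w₁, …, τ₁ w_k)^⊥` exists
(`exists_hermForm_pos_forall_hermForm_eq_zero`); the complexified projection
`π(x) = x - Σᵢ (⟪τ₁ wᵢ, x⟫ / ⟪wᵢ, wᵢ⟫) τ₁ wᵢ` is continuous and fixes `x₀`, so by density of `E^{p+1}` in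
`ℂ^{p+1}` some `y ∈ E^{p+1}` has `π(τ₁ y)` positive, and `w' = y - Σᵢ (⟪wᵢ, y⟫ / ⟪wᵢ, wᵢ⟫) wᵢ` is
`E`-rational with `τ₁ w' = π(τ₁ y)`. [cite: BergeronMillsonMoeglin2016Balls, Part 2 §3.1] -/
theorem exists_pos_forall_hermForm_eq_zero {k : ℕ} (hk : k < p)
    (hsig : ∃ T : GL (Fin (p + 1)) ℂ,
      (T : Matrix (Fin (p + 1)) (Fin (p + 1)) ℂ)ᴴ * H.map E.subtype *
        (T : Matrix (Fin (p + 1)) (Fin (p + 1)) ℂ) = signatureMatrix p)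
    {w : Fin k → Fin (p + 1) → E}
    (hw : ∀ i, 0 < (hermForm (starRingEnd ℂ) (H.map E.subtype) (E.subtype ∘ w i) (E.subtype ∘ w i)).re)
    (horth : ∀ i j, i ≠ j → hermForm (conjRingHom E) H (w i) (w j) = 0) :
    ∃ w' : Fin (p + 1) → E,
      0 < (hermForm (starRingEnd ℂ) (H.map E.subtype) (E.subtype ∘ w') (E.subtype ∘ w')).re ∧
        ∀ i, hermForm (conjRingHom E) H (w i) w' = 0 := by
  obtain ⟨T, hT⟩ := hsig
  have hc : ∀ i, hermForm (conjRingHom E) H (w i) (w i) ≠ 0 := fun i ↦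
    hermForm_self_ne_zero_of_pos E H (hw i)
  -- a positive complex vector orthogonal to all `τ₁ wᵢ`
  obtain ⟨x₀, hx₀, hx₀orth⟩ :=
    exists_hermForm_pos_forall_hermForm_eq_zero hk hT (fun i ↦ E.subtype ∘ w i)
  -- the complexified projection onto `(τ₁ w₁, …, τ₁ w_k)^⊥`
  set πc : (Fin (p + 1) → ℂ) → (Fin (p + 1) → ℂ) := fun x ↦
    x - ∑ i, (hermForm (starRingEnd ℂ) (H.map E.subtype) (E.subtype ∘ w i) x /
      E.subtype (hermForm (conjRingHom E) H (w i) (w i))) • (E.subtype ∘ w i) with hπc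
  have hcoef : ∀ i, Continuous fun x : Fin (p + 1) → ℂ ↦
      hermForm (starRingEnd ℂ) (H.map E.subtype) (E.subtype ∘ w i) x /
        E.subtype (hermForm (conjRingHom E) H (w i) (w i)) := fun i ↦
    (continuous_const.dotProduct (continuous_const.matrix_mulVec continuous_id)).div_const _
  have hπc_cont : Continuous πc :=
    continuous_id.sub (continuous_finsetSum _ fun i _ ↦ (hcoef i).smul continuous_const)
  set O : Set (Fin (p + 1) → ℂ) :=
    {v | 0 < (hermForm (starRingEnd ℂ) (H.map E.subtype) v v).re} with hO_def
  have hO : IsOpen O :=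
    isOpen_lt continuous_const (Complex.continuous_re.comp
      ((continuous_pi fun i ↦ (continuous_apply i).star).dotProduct
        (continuous_const.matrix_mulVec continuous_id)))
  have hx₀O : x₀ ∈ πc ⁻¹' O := by
    have hfix : πc x₀ = x₀ := by
      simp only [hπc, hx₀orth, zero_div, zero_smul, Finset.sum_const_zero, sub_zero]
    show 0 < (hermForm (starRingEnd ℂ) (H.map E.subtype) (πc x₀) (πc x₀)).re
    rw [hfix]
    exact hx₀
  -- density of `E^{p+1}`
  obtain ⟨y, hy⟩ := exists_coe_mem_of_isOpen E (hO.preimage hπc_cont) ⟨x₀, hx₀O⟩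
  -- the `E`-rational projection of `y`
  refine ⟨y - ∑ i, (hermForm (conjRingHom E) H (w i) y / hermForm (conjRingHom E) H (w i) (w i)) • w i,
    ?_, fun j ↦ ?_⟩
  · have hcomp : (E.subtype ∘ (y - ∑ i, (hermForm (conjRingHom E) H (w i) y /
        hermForm (conjRingHom E) H (w i) (w i)) • w i)) = πc (E.subtype ∘ y) := by
      have e1 : ∀ i, E.subtype (hermForm (conjRingHom E) H (w i) y) =
          hermForm (starRingEnd ℂ) (H.map E.subtype) (E.subtype ∘ w i) (E.subtype ∘ y) := fun i ↦
        map_hermForm E.subtype (embedding_conjRingHom E E.subtype) H (w i) y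
      funext r
      simp only [hπc, Function.comp_apply, Pi.sub_apply, Finset.sum_apply, Pi.smul_apply, smul_eq_mul,
        map_sub, map_sum, map_mul, map_div₀, e1]
    rw [hcomp]
    exact hy
  · rw [hermForm_sub_right', hermForm_self_sum_smul (conjRingHom E) H horth _ j,
      div_mul_cancel₀ _ (hc j), sub_self]

/-- **Orthogonal positive families of every size `k ≤ p` exist**: for `E ⊆ ℂ` CM and `H` hermitian on
`E^{p+1}` with a Sylvester frame of signature `(p, 1)` at `τ₁`, there are `w₁, …, w_k ∈ E^{p+1}`, pairwise
orthogonal, each positive at `τ₁` (induction on `k`, extending by `exists_pos_forall_hermForm_eq_zero`).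
[cite: BergeronMillsonMoeglin2016Balls, Part 2 §3.1] -/
theorem exists_orthogonal_pos_family (hH : ∀ i j, conjRingHom E (H i j) = H j i)
    (hsig : ∃ T : GL (Fin (p + 1)) ℂ,
      (T : Matrix (Fin (p + 1)) (Fin (p + 1)) ℂ)ᴴ * H.map E.subtype *
        (T : Matrix (Fin (p + 1)) (Fin (p + 1)) ℂ) = signatureMatrix p)
    {k : ℕ} (hk : k ≤ p) :
    ∃ w : Fin k → Fin (p + 1) → E,
      (∀ i, 0 < (hermForm (starRingEnd ℂ) (H.map E.subtype) (E.subtype ∘ w i) (E.subtype ∘ w i)).re) ∧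
        ∀ i j, i ≠ j → hermForm (conjRingHom E) H (w i) (w j) = 0 := by
  induction k with
  | zero => exact ⟨fun i ↦ i.elim0, fun i ↦ i.elim0, fun i ↦ i.elim0⟩
  | succ k ih =>
    obtain ⟨w, hw, horth⟩ := ih (by omega)
    obtain ⟨w', hw', horth'⟩ := exists_pos_forall_hermForm_eq_zero E H (by omega) hsig hw horth
    refine ⟨Fin.cons w' w, fun i ↦ ?_, fun i j hij ↦ ?_⟩
    · rcases Fin.eq_zero_or_eq_succ i with rfl | ⟨i, rfl⟩
      · rw [Fin.cons_zero]
        exact hw'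
      · rw [Fin.cons_succ]
        exact hw i
    · rcases Fin.eq_zero_or_eq_succ i with rfl | ⟨i, rfl⟩ <;>
        rcases Fin.eq_zero_or_eq_succ j with rfl | ⟨j, rfl⟩
      · exact absurd rfl hij
      · rw [Fin.cons_zero, Fin.cons_succ, ← conjRingHom_hermForm E H hH, horth' j, map_zero]
      · rw [Fin.cons_zero, Fin.cons_succ]
        exact horth' i
      · rw [Fin.cons_succ, Fin.cons_succ]
        exact horth i j fun h ↦ hij (by rw [h])

/-- **Totally positive subspaces of every dimension `k ≤ p` exist.** Let `E ⊆ ℂ` be a CM field and `H` a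
hermitian Gram matrix on `E^{p+1}` with a Sylvester frame of signature `(p, 1)` at `τ₁` and positive
definite at the other complex embeddings. Then for every `k ≤ p` there is a totally positive definite
`E`-subspace `W ⊆ E^{p+1}` with `dim_E W = k` — the converse of "`U ⊂ V` totally positive definite of
dimension `t`. In particular: `0 ≤ t ≤ p`" (BMM Part 2 §3.1; tree:
`UnitaryBallUniformisationDatum.finrank_le_of_isTotallyPositive`): every `n` with `0 ≤ n ≤ p` indexes a
non-empty family of special cycles of codimension `n` (BMM Introduction §1.7).
[cite: BergeronMillsonMoeglin2016Balls, Introduction §1.7 and Part 2 §3.1] -/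
theorem exists_isTotallyPositive_finrank_eq (hH : ∀ i j, conjRingHom E (H i j) = H j i)
    (hsig : ∃ T : GL (Fin (p + 1)) ℂ,
      (T : Matrix (Fin (p + 1)) (Fin (p + 1)) ℂ)ᴴ * H.map E.subtype *
        (T : Matrix (Fin (p + 1)) (Fin (p + 1)) ℂ) = signatureMatrix p)
    (hpos : ∀ τ : E →+* ℂ, InfinitePlace.mk τ ≠ InfinitePlace.mk E.subtype → (H.map τ).PosDef)
    {k : ℕ} (hk : k ≤ p) :
    ∃ W : Submodule E (Fin (p + 1) → E),
      IsTotallyPositive (conjRingHom E) H W ∧ Module.finrank E W = k := by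
  obtain ⟨w, hw, horth⟩ := exists_orthogonal_pos_family E H hH hsig hk
  exact ⟨_, isTotallyPositive_span_of_orthogonal E H hpos hw horth⟩

/-! ### Gram–Schmidt inside a totally positive subspace; every sub-ball is non-empty -/

/-- **Gram–Schmidt inside an anisotropic subspace.** If `⟪w, w⟫ ≠ 0` for every non-zero `w ∈ W` (`H`
hermitian), then `W` is contained in the span of a pairwise orthogonal family of non-zero vectors of `W`
(induction on `dim W`: split off `w₁ ∈ W` and recurse on `W ∩ w₁^⊥`, using
`w = (w - (⟪w₁, w⟫/⟪w₁, w₁⟫) w₁) + (⟪w₁, w⟫/⟪w₁, w₁⟫) w₁`). [folklore] -/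
private theorem exists_orthogonal_family_le_span (hH : ∀ i j, conjRingHom E (H i j) = H j i) (n : ℕ)
    {W : Submodule E (Fin (p + 1) → E)} (hW : (Module.finrank E W : ℕ) ≤ n)
    (han : ∀ w ∈ W, w ≠ 0 → hermForm (conjRingHom E) H w w ≠ 0) :
    ∃ (k : ℕ) (w : Fin k → Fin (p + 1) → E), (∀ i, w i ∈ W) ∧ (∀ i, w i ≠ 0) ∧
      (∀ i j, i ≠ j → hermForm (conjRingHom E) H (w i) (w j) = 0) ∧
        W ≤ Submodule.span E (Set.range w) := by
  induction n generalizing W with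
  | zero =>
    have hW0 : W = ⊥ := Submodule.finrank_eq_zero.1 (Nat.le_zero.1 hW)
    exact ⟨0, fun i ↦ i.elim0, fun i ↦ i.elim0, fun i ↦ i.elim0, fun i ↦ i.elim0,
      by rw [hW0]; exact bot_le⟩
  | succ n ih =>
    by_cases hbot : W = ⊥
    · exact ⟨0, fun i ↦ i.elim0, fun i ↦ i.elim0, fun i ↦ i.elim0, fun i ↦ i.elim0,
        by rw [hbot]; exact bot_le⟩
    obtain ⟨w₁, hw₁W, hw₁⟩ := Submodule.exists_mem_ne_zero_of_ne_bot hbot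
    have hc : hermForm (conjRingHom E) H w₁ w₁ ≠ 0 := han w₁ hw₁W hw₁
    obtain ⟨ℓ, hℓ⟩ := exists_linearMap_hermForm (conjRingHom E) H w₁
    -- `W' = W ∩ w₁^⊥` has smaller dimension
    have hW'le : W ⊓ LinearMap.ker ℓ ≤ W := inf_le_left
    have hW'lt : W ⊓ LinearMap.ker ℓ < W := by
      refine lt_of_le_of_ne hW'le fun h ↦ hc ?_
      have hmem : w₁ ∈ W ⊓ LinearMap.ker ℓ := by
        rw [h]
        exact hw₁W
      rw [Submodule.mem_inf, LinearMap.mem_ker, hℓ] at hmem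
      exact hmem.2
    have hfin : (Module.finrank E ↥(W ⊓ LinearMap.ker ℓ) : ℕ) ≤ n := by
      have hlt := Submodule.finrank_lt_finrank_of_lt hW'lt
      omega
    obtain ⟨k, w, hwW', hw0, horth, hspan⟩ :=
      ih hfin fun v hv hv0 ↦ han v (hW'le hv) hv0
    have hw₁orth : ∀ i, hermForm (conjRingHom E) H w₁ (w i) = 0 := fun i ↦ by
      have hmem := hwW' i
      rw [Submodule.mem_inf, LinearMap.mem_ker, hℓ] at hmem
      exact hmem.2
    refine ⟨k + 1, Fin.cons w₁ w, fun i ↦ ?_, fun i ↦ ?_, fun i j hij ↦ ?_, fun v hv ↦ ?_⟩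
    · rcases Fin.eq_zero_or_eq_succ i with rfl | ⟨i, rfl⟩
      · rw [Fin.cons_zero]
        exact hw₁W
      · rw [Fin.cons_succ]
        exact hW'le (hwW' i)
    · rcases Fin.eq_zero_or_eq_succ i with rfl | ⟨i, rfl⟩
      · rw [Fin.cons_zero]
        exact hw₁
      · rw [Fin.cons_succ]
        exact hw0 i
    · rcases Fin.eq_zero_or_eq_succ i with rfl | ⟨i, rfl⟩ <;>
        rcases Fin.eq_zero_or_eq_succ j with rfl | ⟨j, rfl⟩
      · exact absurd rfl hij
      · rw [Fin.cons_zero, Fin.cons_succ]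
        exact hw₁orth j
      · rw [Fin.cons_zero, Fin.cons_succ, ← conjRingHom_hermForm E H hH, hw₁orth i, map_zero]
      · rw [Fin.cons_succ, Fin.cons_succ]
        exact horth i j fun h ↦ hij (by rw [h])
    · -- `v = (v - a w₁) + a w₁`, the first summand in `W ∩ w₁^⊥ ≤ span w`
      have hv' : v - (hermForm (conjRingHom E) H w₁ v / hermForm (conjRingHom E) H w₁ w₁) • w₁ ∈
          W ⊓ LinearMap.ker ℓ := by
        rw [Submodule.mem_inf, LinearMap.mem_ker, hℓ]
        refine ⟨W.sub_mem hv (W.smul_mem _ hw₁W), ?_⟩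
        rw [hermForm_sub_right', hermForm_smul_right', div_mul_cancel₀ _ hc, sub_self]
      have hrange : Set.range w ⊆ Set.range (Fin.cons w₁ w : Fin (k + 1) → Fin (p + 1) → E) := by
        rintro _ ⟨i, rfl⟩
        exact ⟨i.succ, Fin.cons_succ _ _ _⟩
      have h1 := Submodule.span_mono (R := E) hrange (hspan hv')
      have h2 : w₁ ∈ Submodule.span E (Set.range (Fin.cons w₁ w : Fin (k + 1) → Fin (p + 1) → E)) :=
        Submodule.subset_span ⟨0, Fin.cons_zero _ _⟩
      have h := Submodule.add_mem _ h1 (Submodule.smul_mem _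
        (hermForm (conjRingHom E) H w₁ v / hermForm (conjRingHom E) H w₁ w₁) h2)
      rwa [sub_add_cancel] at h

/-- **Every sub-ball `𝔹(W^⊥)` is non-empty.** Let `E ⊆ ℂ` be a CM field, `H` a hermitian Gram matrix on
`E^{p+1}` with a Sylvester frame of signature `(p, 1)` at `τ₁`, and `W ⊆ E^{p+1}` ANY totally positive
definite `E`-subspace. Then the sub-cone `subCone H^{τ₁} (τ₁ W)` of negative vectors orthogonal to
`τ₁(W)` — which uniformises the special cycle attached to `W` — contains a vector: an orthogonal basis
`w₁, …, w_k` of `W` exists (Gram–Schmidt, `⟪w, w⟫ ≠ 0` on `W ∖ 0` by positivity at `τ₁`), the negative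
vector `v` of `exists_mem_negCone_forall_hermForm_eq_zero` is orthogonal to every `τ₁ wᵢ`, hence to
`τ₁(W)` by sesquilinearity. This is Kudla–Millson's `D_U = {Z ∈ D : Z ⊂ U^⊥} ≠ ∅` for every positive
definite `U` (the symmetric space of `G_U ≅ U(p - k, 1) × (compact)`), i.e. BMM's `X_H ≠ ∅`.
[cite: KudlaMillson1990, §2, pp. 129–131] [cite: BergeronMillsonMoeglin2016Balls, Part 2 §§3.1–3.2] -/
theorem subCone_nonempty_of_isTotallyPositive (hH : ∀ i j, conjRingHom E (H i j) = H j i)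
    (hsig : ∃ T : GL (Fin (p + 1)) ℂ,
      (T : Matrix (Fin (p + 1)) (Fin (p + 1)) ℂ)ᴴ * H.map E.subtype *
        (T : Matrix (Fin (p + 1)) (Fin (p + 1)) ℂ) = signatureMatrix p)
    {W : Submodule E (Fin (p + 1) → E)} (hW : IsTotallyPositive (conjRingHom E) H W) :
    (subCone (H.map E.subtype) ((fun w ↦ E.subtype ∘ w) '' (W : Set (Fin (p + 1) → E)))).Nonempty := by
  obtain ⟨T, hT⟩ := hsig
  have hposW : ∀ w ∈ W, w ≠ 0 →
      0 < (hermForm (starRingEnd ℂ) (H.map E.subtype) (E.subtype ∘ w) (E.subtype ∘ w)).re := by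
    intro w hw hw0
    rw [← map_hermForm E.subtype (embedding_conjRingHom E E.subtype)]
    exact hW w hw hw0 E.subtype
  have han : ∀ w ∈ W, w ≠ 0 → hermForm (conjRingHom E) H w w ≠ 0 := fun w hw hw0 ↦
    hermForm_self_ne_zero_of_pos E H (hposW w hw hw0)
  -- an orthogonal basis of `W`
  obtain ⟨k, w, hwW, hw0, horth, hspan⟩ :=
    exists_orthogonal_family_le_span E H hH _ le_rfl han
  have hu : ∀ i, 0 < (hermForm (starRingEnd ℂ) (H.map E.subtype)
      (E.subtype ∘ w i) (E.subtype ∘ w i)).re := fun i ↦ hposW _ (hwW i) (hw0 i)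
  have huorth : ∀ i j, i ≠ j →
      hermForm (starRingEnd ℂ) (H.map E.subtype) (E.subtype ∘ w i) (E.subtype ∘ w j) = 0 := by
    intro i j hij
    rw [← map_hermForm E.subtype (embedding_conjRingHom E E.subtype), horth i j hij, map_zero]
  -- a negative vector orthogonal to the basis
  obtain ⟨v, hv, hvorth⟩ := exists_mem_negCone_forall_hermForm_eq_zero
    (isHermitian_map_embedding E H hH E.subtype) hT hu huorth
  refine ⟨v, hv, ?_⟩
  rintro _ ⟨x, hx, rfl⟩
  obtain ⟨c, hc⟩ := (Submodule.mem_span_range_iff_exists_fun E).1 (hspan hx)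
  have hcomp : E.subtype ∘ x = ∑ i, (E.subtype (c i)) • (E.subtype ∘ w i) := by
    rw [← hc]
    funext r
    simp [Finset.sum_apply]
  show hermForm (starRingEnd ℂ) (H.map E.subtype) (E.subtype ∘ x) v = 0
  rw [hcomp, hermForm_sum_left, Finset.sum_eq_zero]
  intro i _
  rw [hermForm_smul_left, hvorth i, mul_zero]

end TotallyPositiveThree

/-! ### Datum level: every codimension -/

namespace UnitaryBallUniformisationDatum

variable {p : ℕ} {X : SchemeOver ℂ} (D : UnitaryBallUniformisationDatum p X)

/-- **A ball-quotient datum of dimension `p` has totally positive subspaces `W ⊆ V = E^{p+1}` of every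
dimension `k ≤ p`**: the family indexing the special cycles of codimension `k` (BMM §1.7, `n = k`) is
non-empty for every `0 ≤ k ≤ p`. [cite: BergeronMillsonMoeglin2016Balls, Introduction §1.7 and Part 2 §3.1] -/
theorem exists_isTotallyPositive_finrank_eq {k : ℕ} (hk : k ≤ p) :
    ∃ W : Submodule D.E (Fin (p + 1) → D.E),
      IsTotallyPositive (conjRingHom D.E) D.H W ∧ Module.finrank D.E W = k :=
  _root_.Literature.AlgebraicGeometry.ShimuraVarieties.exists_isTotallyPositive_finrank_eq D.E D.H
    D.conj_H_apply D.signature_τ₁ D.posDef_of_ne hk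

/-- **`0 ≤ t ≤ p`, and conversely**: a totally positive definite `W ⊆ V` of dimension `k` exists if and
only if `k ≤ p` (BMM Part 2 §3.1 "In particular: `0 ≤ t ≤ p`" = the tree's
`finrank_le_of_isTotallyPositive`; the converse is `exists_isTotallyPositive_finrank_eq`).
[cite: BergeronMillsonMoeglin2016Balls, Part 2 §3.1] -/
theorem exists_isTotallyPositive_finrank_eq_iff (k : ℕ) :
    (∃ W : Submodule D.E (Fin (p + 1) → D.E),
      IsTotallyPositive (conjRingHom D.E) D.H W ∧ Module.finrank D.E W = k) ↔ k ≤ p :=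
  ⟨fun ⟨_, hW, hk⟩ ↦ hk ▸ D.finrank_le_of_isTotallyPositive hW, D.exists_isTotallyPositive_finrank_eq⟩

/-- **Every sub-ball is non-empty** (datum form): for ANY totally positive `W ⊆ V`, the sub-cone
`subCone H^{τ₁} (τ₁ W)` uniformising the special cycle of `W` contains a vector (Kudla–Millson:
`D_U ≠ ∅`). [cite: KudlaMillson1990, §2, pp. 129–131] -/
theorem subCone_nonempty_of_isTotallyPositive {W : Submodule D.E (Fin (p + 1) → D.E)}
    (hW : IsTotallyPositive (conjRingHom D.E) D.H W) :
    (subCone D.Hℂ ((fun w ↦ D.τ₁ ∘ w) '' (W : Set (Fin (p + 1) → D.E)))).Nonempty :=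
  _root_.Literature.AlgebraicGeometry.ShimuraVarieties.subCone_nonempty_of_isTotallyPositive D.E D.H
    D.conj_H_apply D.signature_τ₁ hW

/-- Hence the special cycle `unif '' subCone(τ₁ W)` of ANY totally positive `W`, as a set of complex
points of `X`, is non-empty. [cite: BergeronMillsonMoeglin2016Balls, Introduction §1.7] -/
theorem image_unif_subCone_nonempty_of_isTotallyPositive {W : Submodule D.E (Fin (p + 1) → D.E)}
    (hW : IsTotallyPositive (conjRingHom D.E) D.H W) :
    (D.unif '' subCone D.Hℂ ((fun w ↦ D.τ₁ ∘ w) '' (W : Set (Fin (p + 1) → D.E)))).Nonempty :=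
  (D.subCone_nonempty_of_isTotallyPositive hW).image _

end UnitaryBallUniformisationDatum

namespace UnitaryBallQuotientDatum

open _root_.AlgebraicGeometry

variable {p : ℕ} {X : SchemeOver ℂ} (D : UnitaryBallQuotientDatum p X)

/-- **Every special subvariety has complex points**: for ANY totally positive `W ⊆ V` there is
`P ∈ X(ℂ)` with `P.pt ∈ D.specialSubvariety W` (its complex points are the images of the non-empty
sub-ball `𝔹(W^⊥)`). [cite: BergeronMillsonMoeglin2016Balls, Introduction §1.7 and Part 2 §3.2]
[cite: KudlaMillson1990, §2, pp. 129–131] -/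
theorem exists_pt_mem_specialSubvariety_of_isTotallyPositive {W : Submodule D.E (Fin (p + 1) → D.E)}
    (hW : IsTotallyPositive (conjRingHom D.E) D.H W) :
    ∃ P : ComplexPoints X, P.pt ∈ D.specialSubvariety W := by
  obtain ⟨P, hP⟩ := D.image_unif_subCone_nonempty_of_isTotallyPositive hW
  exact ⟨P, (D.pt_mem_specialSubvariety_iff W hW P).2 hP⟩

/-- **The special subvariety of `W = 0` is all of `X`** (as a set of scheme points, not only of
complex points): it is Zariski closed and contains every closed point
(`pt_mem_specialSubvariety_bot`; complex points = closed points by the Nullstellensatz), and the closed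
points of the Jacobson scheme `X` are dense. [cite: BergeronMillsonMoeglin2016Balls, Part 2 §3.3]
[cite: GortzWedhorn2020, Prop. 3.35 and Cor. 3.36] -/
theorem specialSubvariety_bot_eq_univ : D.specialSubvariety ⊥ = Set.univ := by
  have h0 : IsTotallyPositive (conjRingHom D.E) D.H ⊥ := fun w hw hne ↦
    (hne ((Submodule.mem_bot _).1 hw)).elim
  by_contra hne
  haveI := D.isSmoothProjective.smoothOfRelativeDimension
  haveI : Smooth X.hom := SmoothOfRelativeDimension.smooth p X.hom
  obtain ⟨P, hP⟩ := exists_pt_mem_of_isOpen (D.isClosed_specialSubvariety ⊥ h0).isOpen_compl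
    (Set.nonempty_compl.2 hne)
  exact hP (D.pt_mem_specialSubvariety_bot P)

/-- **Non-vacuity of the special-cycle record in EVERY codimension `1 ≤ k ≤ p`.** A compact connected
Shimura variety of simple unitary type `X(ℂ) ≅ Γ\𝔹ᵖ` (the datum `D`) carries, for every `k` with
`1 ≤ k ≤ p`, a totally positive definite `W ⊆ V = E^{p+1}` of dimension `k` whose special subvariety
`D.specialSubvariety W` (the special cycle of codimension `k`: a ball quotient for `U(p - k, 1)`) has
complex points and is not all of `X`; in particular the special cycle classes `specialCycleClasses D k`
are indexed by a non-empty family of genuine proper subvarieties for every such `k` (BMM §1.7: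
`SC^•(S) = ⊕_{n=0}^p SC^{2nq}(S)`). [cite: BergeronMillsonMoeglin2016Balls, Introduction §1.7 and Part 2 §§3.1–3.3]
[cite: KudlaMillson1990, §2, pp. 129–131] -/
theorem exists_specialSubvariety_nonempty_ne_univ {k : ℕ} (hk : k ≤ p) (h0 : 0 < k) :
    ∃ W : Submodule D.E (Fin (p + 1) → D.E), IsTotallyPositive (conjRingHom D.E) D.H W ∧
      Module.finrank D.E W = k ∧ (∃ P : ComplexPoints X, P.pt ∈ D.specialSubvariety W) ∧
        D.specialSubvariety W ≠ Set.univ := by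
  obtain ⟨W, hW, hWk⟩ := D.exists_isTotallyPositive_finrank_eq hk
  have hW0 : W ≠ ⊥ := by
    rintro rfl
    rw [finrank_bot] at hWk
    omega
  exact ⟨W, hW, hWk, D.exists_pt_mem_specialSubvariety_of_isTotallyPositive hW,
    D.specialSubvariety_ne_univ hW hW0⟩

/-- **Exactly the range `1 ≤ k ≤ p`.** A totally positive `W ⊆ V` of dimension `k` with non-empty and
proper special subvariety exists if and only if `1 ≤ k ≤ p`: `k ≤ p` by
`finrank_le_of_isTotallyPositive` (BMM Part 2 §3.1), `k ≠ 0` because the special subvariety of `W = 0`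
is all of `X` (`specialSubvariety_bot_eq_univ`), and conversely
`exists_specialSubvariety_nonempty_ne_univ`. [cite: BergeronMillsonMoeglin2016Balls, Introduction §1.7 and Part 2 §§3.1–3.3] -/
theorem exists_specialSubvariety_nonempty_ne_univ_iff (k : ℕ) :
    (∃ W : Submodule D.E (Fin (p + 1) → D.E), IsTotallyPositive (conjRingHom D.E) D.H W ∧
      Module.finrank D.E W = k ∧ (∃ P : ComplexPoints X, P.pt ∈ D.specialSubvariety W) ∧
        D.specialSubvariety W ≠ Set.univ) ↔ 0 < k ∧ k ≤ p := by
  refine ⟨fun ⟨W, hW, hWk, _, hne⟩ ↦ ⟨Nat.pos_of_ne_zero ?_, hWk ▸ D.finrank_le_of_isTotallyPositive hW⟩,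
    fun ⟨h0, hk⟩ ↦ D.exists_specialSubvariety_nonempty_ne_univ hk h0⟩
  rintro rfl
  have hW0 : W = ⊥ := Submodule.finrank_eq_zero.1 hWk
  exact hne (hW0 ▸ D.specialSubvariety_bot_eq_univ)

end UnitaryBallQuotientDatum

end Literature.AlgebraicGeometry.ShimuraVarieties

end

-- buildfix 2026-08-21 (ops-buildfix-2): comment-only re-land to re-queue the hub build of this module
-- (accepted 06:40-07:30Z but never dispatched to the build lane, HOME LEDGER G11b-3); no declaration changed.
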